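import Mathlib
import HarnessLib
import Literature.NumberTheory.LFunctions.ProlateExistsUnique
import Literature.Analysis.ValidatedNumerics.IntervalPolynomial

/-!
# Kernel-checked enclosures of the even prolate spheroidal wave functions at `c = 2π`
# (Frobenius-series certificates): `λ(n)²`, `ψ_n(1)²λ(n)²` and `2λ(n)²ψ_n(1)²/(1 − λ(n)²)`, `n ≤ 3`

RH-FREE (line 1): certified real analysis / validated numerics for the classical prolate spheroidal
wave functions; nothing in this file mentions `ζ`, Weil positivity or RH, and nothing here bears on
the truth of RH.  Topic `Literature/NumberTheory/LFunctions` (next to the tree's prolate files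
`ProlateFrobenius.lean`, `ProlateExistence.lean`, `ProlateExistsUnique.lean`, `ProlateUniqueness.lean`,
whose objects it certifies numerically); the interval kernels are the tree's
`Literature.Analysis.ValidatedNumerics` (`MultiPrecisionInterval.lean`: `MI`; `IntervalPolynomial.lean`:
`IPoly`, `posOn`/`negOn`).  Everything here is PROVED (no named fact, no `sorry`); the four
certificates are evaluated by the KERNEL (`decide +kernel`, standard axioms only).

## What is certified

For the tree's prolate functions `h_{2k,1}` (`IsProlateFunction 1 (2k) f`: the principal
eigenfunction of `−∂(1 − x²)∂ + (2πx)²` on `(−1, 1)` with `2k` zeros, `∫_{−1}^{1} f² = 1`, `f(0) > 0`,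
`f = 0` off `[−1, 1]`; these are `PS_{2k,0}(2π, ·)` normalised — the `ξ_n/√2` of Connes–Consani 2021
§4), writing `λ := (∫ f)/f(0)` (the eigenvalue of the finite cosine transform on `f`, the `λ(k)` of
Connes–Consani 2021 §4 p. 16 / `prolateEigen` of the cell's `ProlateProjections.lean`), the theorems
`enclosures_zero` … `enclosures_three` give, for `k = 0, 1, 2, 3`:

* `λ(k)² ∈ [0.9999427, 0.9999428], [0.9593903, 0.9593904], [0.274666, 0.2746661], [0.003478237, 0.003478239]`
  (so `|λ(k)| = 0.99997137…, 0.97948473…, 0.52408589…, 0.05897659…` — the printed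
  `0.999971, −0.979485, 0.524086, −0.0589766` of CC2021 §4 p. 16 up to sign);
* `(λ(k) f(1))² ≥ 0.0003426764, 0.1781899, 0.7997808, 0.02162363`;
* `t(k) := 2λ(k)²f(1)²/(1 − λ(k)²) ∈ [11.97171, 11.97215], [8.775741, 8.775745], [2.205276, 2.205277],
  [0.04339821, 0.04339835]` — the terms of Connes–Consani 2021 Lemma 5.4 (`ε′(1₊) = Σ t(n)`, printed
  `t(0..3) = 11.9719, 8.77574, 2.20528, 0.0433983`; in their normalisation `ξ_n = √2 f`,
  `t(n) = λ(n)²ξ_n(1)²/(1 − λ(n)²)`).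

## Method (all steps proved in this file)

1. **Frobenius series at the regular singular point `x = 1`** (tree: `frobSol 1 χ`, `frobCoeff`,
   four-term recursion `frobCoeff_rec`, radius `2`): an explicit SELF-PROPAGATING GEOMETRIC MAJORANT
   `|a_j| ≤ C (3/4)^j` for `j ≥ J` from the three window values `a_J, a_{J+1}, a_{J+2}` and one
   inequality in `J` (`frobCoeff_geom`; the tree's `frobCoeff_bound` is existential), hence explicit
   tails of the value and derivative series on `x ∈ [0, 1]` (`value_remainder_le`, `deriv_remainder_le`).
2. **Interval recursion** for `a_0 … a_{J+2}` with the parameter `χ` and `π` as intervals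
   (`tripleI`, `coeffsI`, `mem_tripleI`; `π` from Mathlib's `Real.pi_gt_d20`/`pi_lt_d20`), the widened
   value / derivative interval polynomials `valPolyW`, `derPolyW` that enclose `u_χ(1 − t)` and
   `−u′_χ(1 − t)` EXACTLY (`exists_pmem_valPolyW`), point signs by interval Horner (`sgnAt`, `bsgn`),
   cell signs by the tree's `posOn`/`negOn` (Taylor shift + bisection), and the integrals
   `u_χ(0)`, `∫₀¹u_χ`, `∫₀¹u_χ²` by termwise moments (`u0I`, `i1I`, `i2I`).
3. **Shooting, certified**: a bracket `[blo, bhi]` with a certified sign change of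
   `B(χ) = u′_χ(0)` gives `b` with `u_b′(0) = 0` (tree: `continuous_frobSol₁_zero`); `k` certified
   sign alternations of `u_{blo}` on `[0,1)` give `N(blo) ≥ k` (`le_frobZeros_of_altOK`), a
   certified partition of `[0,1]` into zero-free and monotone cells of `u_{bhi}` gives `N(bhi) ≤ k`
   (`frobZeros_le_of_cellsOK`), so `N(b) = k` by the tree's Sturm monotonicity `frobZeros_mono`.
4. **Identification**: the explicit normalised even extension of `u_b` (`frobWitness`, the witness
   of the tree's `exists_isProlateFunction_of_frobSol` made explicit) IS the prolate function with
   `2k` zeros by the tree's uniqueness theorem `IsProlateFunction.unique`, whence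
   `f(1)² = 1/(2∫₀¹u_b²)`, `λ = 2∫₀¹u_b / u_b(0)` (`values_of_frob`) and the enclosures
   (`Cert.sound`, `Cert.enclosures`).

References: the Frobenius method / shooting [Coddington–Levinson 1955, Ch. 4 §8, Ch. 8 §2];
the prolate functions [Slepian–Pollak 1961, §III]; interval arithmetic [Moore 1966, Ch. 2–4]; the
constants being certified [Connes–Consani 2021 (arXiv:2006.13771), §4 p. 16 (λ(n)), Lemma 5.4 p. 19
(t(n))].  WHAT THIS IS NOT: no statement about `ζ`, Weil positivity or RH; no claim beyond the four
listed functions (`k ≤ 3`); the decimal enclosures are outward-rounded to 7 significant digits (the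
kernel intervals are ≈ 10⁻⁹ wide).  Written by the rh-crit cell's Summits-side prover (seat cc-iso)
for the registered stub `stub_slopeValue` of route `ConnesConsaniSemilocal` (item stmt-RiemannHypothesis-19308).
-/

noncomputable section

open Real Set Filter MeasureTheory intervalIntegral Finset
open scoped Topology BigOperators Interval

namespace Literature.NumberTheory.LFunctions

namespace ProlateCert

/-! ### The recursion at `λ = 1` -/

/-- The four-term recursion of the Frobenius coefficients at `λ = 1`, solved for `a_{k+1}`.
[cite: CoddingtonLevinson1955, Ch. 4 §8] -/
theorem frobCoeff_succ_one (χ : ℝ) (k : ℕ) :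
    frobCoeff 1 χ (k + 1) =
      (((k : ℝ) * ((k : ℝ) + 1) - χ + 4 * π ^ 2) * frobCoeff 1 χ k
        - 8 * π ^ 2 * frobPrev 1 χ k + 4 * π ^ 2 * frobPrev₂ 1 χ k) / (2 * ((k : ℝ) + 1) ^ 2) := by
  rw [frobCoeff_succ]
  simp only [one_pow, mul_one]

/-- `a_{k+2}`'s predecessor bookkeeping: `frobPrev 1 χ (k+1) = a_k`, `frobPrev₂ 1 χ (k+2) = a_k`.
[cite: CoddingtonLevinson1955, Ch. 4 §8] -/
theorem frobPrev₂_succ_succ (χ : ℝ) (k : ℕ) : frobPrev₂ 1 χ (k + 2) = frobCoeff 1 χ k := by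
  rw [frobPrev₂_succ, frobPrev_succ]

/-! ### The self-propagating geometric majorant `|a_j| ≤ C r^j` -/

/-- The propagation condition at index `j`: `(j(j+1) + M) r² + 8π² r + 4π² ≤ 2 (j+1)² r³`. [cite: CoddingtonLevinson1955, Ch. 4 §8] -/
def Cond (M r : ℝ) (j : ℕ) : Prop :=
  (((j : ℝ) * ((j : ℝ) + 1) + M) * r ^ 2 + 8 * π ^ 2 * r + 4 * π ^ 2) ≤ 2 * ((j : ℝ) + 1) ^ 2 * r ^ 3

/-- The propagation condition is monotone in `j` when `r ≥ 1/2`. [cite: CoddingtonLevinson1955, Ch. 4 §8] -/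
theorem cond_mono {r M : ℝ} (hr : 1 / 2 ≤ r) {j : ℕ} (h : Cond M r j) : Cond M r (j + 1) := by
  unfold Cond at *
  push_cast
  have hj : (0 : ℝ) ≤ j := Nat.cast_nonneg j
  have hr0 : 0 ≤ r := by linarith
  nlinarith [mul_nonneg (mul_nonneg hr0 hr0) (by linarith : (0:ℝ) ≤ 2 * r - 1),
    mul_nonneg (mul_nonneg (mul_nonneg hr0 hr0) (by linarith : (0:ℝ) ≤ 2 * r - 1)) hj]

/-- Iterated monotonicity of the propagation condition. [cite: CoddingtonLevinson1955, Ch. 4 §8] -/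
theorem cond_of_le {r M : ℝ} (hr : 1 / 2 ≤ r) {J j : ℕ} (h : Cond M r J) (hj : J ≤ j) : Cond M r j := by
  obtain ⟨n, rfl⟩ := Nat.exists_eq_add_of_le hj
  induction n with
  | zero => simpa using h
  | succ n ih => exact cond_mono hr (ih (Nat.le_add_right _ _))

/-- **Geometric majorant of the Frobenius coefficients (`λ = 1`).**  If `|4π² − χ| ≤ M`, `1/2 ≤ r`,
the propagation condition holds at `J`, and `|a_j| ≤ C r^j` for `j = J, J+1, J+2`, then
`|a_j| ≤ C r^j` for every `j ≥ J`.  Proof: the recursion gives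
`|a_{m+1}| ≤ ((m(m+1)+M) r² + 8π² r + 4π²) C r^{m−2} / (2(m+1)²) ≤ C r^{m+1}`.
[cite: CoddingtonLevinson1955, Ch. 4 §8 (convergence proof)] -/
theorem frobCoeff_geom {χ M C r : ℝ} {J : ℕ} (hM : |4 * π ^ 2 - χ| ≤ M) (hr : 1 / 2 ≤ r)
    (hcond : Cond M r J)
    (h0 : |frobCoeff 1 χ J| ≤ C * r ^ J) (h1 : |frobCoeff 1 χ (J + 1)| ≤ C * r ^ (J + 1))
    (h2 : |frobCoeff 1 χ (J + 2)| ≤ C * r ^ (J + 2)) :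
    ∀ j, J ≤ j → |frobCoeff 1 χ j| ≤ C * r ^ j := by
  have hr0 : 0 < r := by linarith
  have hM0 : 0 ≤ M := (abs_nonneg _).trans hM
  have hC : 0 ≤ C :=
    (mul_nonneg_iff_of_pos_right (pow_pos hr0 J)).mp ((abs_nonneg _).trans h0)
  -- sliding window: bounds at J+n, J+n+1, J+n+2
  have key : ∀ n : ℕ,
      |frobCoeff 1 χ (J + n)| ≤ C * r ^ (J + n) ∧
        |frobCoeff 1 χ (J + n + 1)| ≤ C * r ^ (J + n + 1) ∧
        |frobCoeff 1 χ (J + n + 2)| ≤ C * r ^ (J + n + 2) := by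
    intro n
    induction n with
    | zero => exact ⟨by simpa using h0, by simpa using h1, by simpa using h2⟩
    | succ n ih =>
      obtain ⟨ha, hb, hc⟩ := ih
      refine ⟨?_, ?_, ?_⟩
      · have e : J + (n + 1) = J + n + 1 := by omega
        rw [e]; exact hb
      · have e : J + (n + 1) + 1 = J + n + 2 := by omega
        rw [e]; exact hc
      · -- the new coefficient a_{J+n+3} from the recursion at m = J+n+2
        set m : ℕ := J + n + 2 with hm
        have hm3 : J + (n + 1) + 2 = m + 1 := by omega
        rw [hm3, frobCoeff_succ_one χ m]
        have hp1 : frobPrev 1 χ m = frobCoeff 1 χ (J + n + 1) := by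
          rw [hm, show J + n + 2 = (J + n + 1) + 1 by omega, frobPrev_succ]
        have hp2 : frobPrev₂ 1 χ m = frobCoeff 1 χ (J + n) := by
          rw [hm, frobPrev₂_succ_succ]
        rw [hp1, hp2]
        have hcm : Cond M r m := cond_of_le hr hcond (by omega)
        unfold Cond at hcm
        have hmpos : (0 : ℝ) < 2 * ((m : ℝ) + 1) ^ 2 := by positivity
        rw [abs_div, abs_of_pos hmpos, div_le_iff₀ hmpos]
        have hmm : 0 ≤ (m : ℝ) * ((m : ℝ) + 1) := by positivity
        have hcoef : |(m : ℝ) * ((m : ℝ) + 1) - χ + 4 * π ^ 2| ≤ (m : ℝ) * ((m : ℝ) + 1) + M := by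
          calc |(m : ℝ) * ((m : ℝ) + 1) - χ + 4 * π ^ 2|
              = |(m : ℝ) * ((m : ℝ) + 1) + (4 * π ^ 2 - χ)| := by ring_nf
            _ ≤ |(m : ℝ) * ((m : ℝ) + 1)| + |4 * π ^ 2 - χ| := abs_add_le _ _
            _ ≤ (m : ℝ) * ((m : ℝ) + 1) + M := by rw [abs_of_nonneg hmm]; gcongr
        have hnum : |((m : ℝ) * ((m : ℝ) + 1) - χ + 4 * π ^ 2) * frobCoeff 1 χ m
              - 8 * π ^ 2 * frobCoeff 1 χ (J + n + 1) + 4 * π ^ 2 * frobCoeff 1 χ (J + n)|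
            ≤ ((m : ℝ) * ((m : ℝ) + 1) + M) * (C * r ^ (J + n + 2))
              + 8 * π ^ 2 * (C * r ^ (J + n + 1)) + 4 * π ^ 2 * (C * r ^ (J + n)) := by
          have e1 : frobCoeff 1 χ m = frobCoeff 1 χ (J + n + 2) := by rw [hm]
          rw [e1]
          have t1 : |((m : ℝ) * ((m : ℝ) + 1) - χ + 4 * π ^ 2) * frobCoeff 1 χ (J + n + 2)|
              ≤ ((m : ℝ) * ((m : ℝ) + 1) + M) * (C * r ^ (J + n + 2)) := by
            rw [abs_mul]; exact mul_le_mul hcoef hc (abs_nonneg _) (add_nonneg hmm hM0)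
          have t2 : |8 * π ^ 2 * frobCoeff 1 χ (J + n + 1)| ≤ 8 * π ^ 2 * (C * r ^ (J + n + 1)) := by
            rw [abs_mul, abs_of_pos (by positivity : (0:ℝ) < 8 * π ^ 2)]
            exact mul_le_mul_of_nonneg_left hb (by positivity)
          have t3 : |4 * π ^ 2 * frobCoeff 1 χ (J + n)| ≤ 4 * π ^ 2 * (C * r ^ (J + n)) := by
            rw [abs_mul, abs_of_pos (by positivity : (0:ℝ) < 4 * π ^ 2)]
            exact mul_le_mul_of_nonneg_left ha (by positivity)
          calc _ ≤ |((m : ℝ) * ((m : ℝ) + 1) - χ + 4 * π ^ 2) * frobCoeff 1 χ (J + n + 2)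
                    - 8 * π ^ 2 * frobCoeff 1 χ (J + n + 1)| + |4 * π ^ 2 * frobCoeff 1 χ (J + n)| :=
                abs_add_le _ _
            _ ≤ (|((m : ℝ) * ((m : ℝ) + 1) - χ + 4 * π ^ 2) * frobCoeff 1 χ (J + n + 2)|
                    + |8 * π ^ 2 * frobCoeff 1 χ (J + n + 1)|) + |4 * π ^ 2 * frobCoeff 1 χ (J + n)| := by
                gcongr; exact abs_sub _ _
            _ ≤ _ := by linarith
        have hpow : C * r ^ (m + 1) * (2 * ((m : ℝ) + 1) ^ 2)
            = C * r ^ (J + n) * (2 * ((m : ℝ) + 1) ^ 2 * r ^ 3) := by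
          rw [hm]; ring
        calc _ ≤ ((m : ℝ) * ((m : ℝ) + 1) + M) * (C * r ^ (J + n + 2))
              + 8 * π ^ 2 * (C * r ^ (J + n + 1)) + 4 * π ^ 2 * (C * r ^ (J + n)) := hnum
          _ = C * r ^ (J + n) * ((((m : ℝ) * ((m : ℝ) + 1) + M) * r ^ 2 + 8 * π ^ 2 * r + 4 * π ^ 2)) := by
              ring
          _ ≤ C * r ^ (J + n) * (2 * ((m : ℝ) + 1) ^ 2 * r ^ 3) :=
              mul_le_mul_of_nonneg_left hcm (mul_nonneg hC (pow_pos hr0 _).le)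
          _ = C * r ^ (m + 1) * (2 * ((m : ℝ) + 1) ^ 2) := hpow.symm
  intro j hj
  obtain ⟨n, rfl⟩ := Nat.exists_eq_add_of_le hj
  exact (key n).1

/-! ### Summability, splitting and tails of the two series on `t ∈ [0, 1]` (`x = 1 − t`) -/

/-- The Frobenius series `Σ a_j t^j` is summable for `|t| < 2` (radius `2λ = 2`).
[cite: CoddingtonLevinson1955, Ch. 4 §8] -/
theorem summable_series (χ : ℝ) {t : ℝ} (ht : |t| < 2) :
    Summable fun j : ℕ ↦ frobCoeff 1 χ j * t ^ j := by
  refine summable_of_le_frobCoeff one_pos χ (by linarith : |t| < 2 * 1) 0 0 (K := 1) fun k ↦ ?_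
  rw [abs_mul, abs_pow]
  simp

/-- The derivative series `Σ (k+1) a_{k+1} t^k` is summable for `|t| < 2`.
[cite: CoddingtonLevinson1955, Ch. 4 §8] -/
theorem summable_derivSeries (χ : ℝ) {t : ℝ} (ht : |t| < 2) :
    Summable fun k : ℕ ↦ ((k : ℝ) + 1) * frobCoeff 1 χ (k + 1) * t ^ k := by
  refine summable_of_le_frobCoeff one_pos χ (by linarith : |t| < 2 * 1) 1 1 (K := 1) fun k ↦ ?_
  rw [abs_mul, abs_mul, abs_pow, abs_of_nonneg (by positivity : (0:ℝ) ≤ (k : ℝ) + 1)]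
  simp

/-- `u_χ(1 − t) = Σ_{j<N} a_j t^j + Σ_{j ≥ N} a_j t^j` for `|t| < 2`. [cite: CoddingtonLevinson1955, Ch. 4 §8] -/
theorem frobSol_split (χ : ℝ) {t : ℝ} (ht : |t| < 2) (N : ℕ) :
    frobSol 1 χ (1 - t) = ∑ j ∈ Finset.range N, frobCoeff 1 χ j * t ^ j
      + ∑' j, frobCoeff 1 χ (j + N) * t ^ (j + N) := by
  rw [frobSol, show (1 : ℝ) - (1 - t) = t by ring]
  exact ((summable_series χ ht).sum_add_tsum_nat_add N).symm

/-- `u′_χ(1 − t) = −(Σ_{k<K} (k+1) a_{k+1} t^k + Σ_{k ≥ K} (k+1) a_{k+1} t^k)` for `|t| < 2`.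
[cite: CoddingtonLevinson1955, Ch. 4 §8] -/
theorem frobSol₁_split (χ : ℝ) {t : ℝ} (ht : |t| < 2) (K : ℕ) :
    frobSol₁ 1 χ (1 - t) = -(∑ k ∈ Finset.range K, ((k : ℝ) + 1) * frobCoeff 1 χ (k + 1) * t ^ k
      + ∑' k, (((k + K : ℕ) : ℝ) + 1) * frobCoeff 1 χ (k + K + 1) * t ^ (k + K)) := by
  rw [frobSol₁, show (1 : ℝ) - (1 - t) = t by ring]
  rw [← (summable_derivSeries χ ht).sum_add_tsum_nat_add K]

/-- Geometric tail bound: if `|f (j + N)| ≤ C r^{j+N}` for all `j` and `0 ≤ r < 1`, then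
`|Σ' j, f (j + N)| ≤ C r^N / (1 − r)`. [cite: Johansson2019, Sect. 4.1 Thm. 1] -/
theorem abs_tsum_shift_le {f : ℕ → ℝ} {C r : ℝ} {N : ℕ} (hf : Summable f) (hr0 : 0 ≤ r) (hr1 : r < 1)
    (hb : ∀ j, |f (j + N)| ≤ C * r ^ (j + N)) :
    |∑' j, f (j + N)| ≤ C * r ^ N / (1 - r) := by
  have hsN : Summable fun j ↦ f (j + N) := (summable_nat_add_iff N).mpr hf
  have hgeo : Summable fun j : ℕ ↦ C * r ^ (j + N) := by
    have := (summable_geometric_of_lt_one hr0 hr1).mul_left (C * r ^ N)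
    refine this.congr fun j ↦ ?_
    rw [pow_add]; ring
  calc |∑' j, f (j + N)| ≤ ∑' j, |f (j + N)| := by
        have h := norm_tsum_le_tsum_norm hsN.norm
        simpa only [Real.norm_eq_abs] using h
    _ ≤ ∑' j, C * r ^ (j + N) := hsN.abs.tsum_le_tsum hb hgeo
    _ = C * r ^ N * ∑' j : ℕ, r ^ j := by
        rw [← tsum_mul_left]; congr 1; funext j; rw [pow_add]; ring
    _ = C * r ^ N / (1 - r) := by
        rw [tsum_geometric_of_lt_one hr0 hr1, div_eq_mul_inv]

/-- **Tail of the value series on `[0,1]`.**  If `|a_j| ≤ C r^j` for `j ≥ N` (`0 ≤ r < 1`) and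
`0 ≤ t ≤ 1`, then `|Σ_{j≥N} a_j t^j| ≤ C r^N/(1 − r)`. [cite: Johansson2019, Sect. 4.1 Thm. 1] -/
theorem abs_valueTail_le {χ C r t : ℝ} {N : ℕ} (hr0 : 0 ≤ r) (hr1 : r < 1) (ht0 : 0 ≤ t) (ht1 : t ≤ 1)
    (hb : ∀ j, N ≤ j → |frobCoeff 1 χ j| ≤ C * r ^ j) :
    |∑' j, frobCoeff 1 χ (j + N) * t ^ (j + N)| ≤ C * r ^ N / (1 - r) := by
  have ht' : |t| < 2 := by rw [abs_of_nonneg ht0]; linarith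
  refine abs_tsum_shift_le (f := fun j ↦ frobCoeff 1 χ j * t ^ j) (summable_series χ ht') hr0 hr1 ?_
  intro j
  have hC : 0 ≤ C * r ^ (j + N) := (abs_nonneg _).trans (hb (j + N) (Nat.le_add_left N j))
  rw [abs_mul, abs_pow, abs_of_nonneg ht0]
  calc |frobCoeff 1 χ (j + N)| * t ^ (j + N) ≤ C * r ^ (j + N) * 1 :=
        mul_le_mul (hb _ (Nat.le_add_left N j)) (pow_le_one₀ ht0 ht1) (by positivity) hC
    _ = C * r ^ (j + N) := mul_one _

/-- **Tail of the derivative series on `[0,1]`.**  If `|a_j| ≤ C r^j` for `j ≥ K + 1`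
(`0 ≤ C`, `0 ≤ r < 1`) and `0 ≤ t ≤ 1`, then
`|Σ_{k≥K} (k+1) a_{k+1} t^k| ≤ C r^{K+1} ((K+1)/(1−r) + r/(1−r)²)`. [cite: Johansson2019, Sect. 4.1 Thm. 1] -/
theorem abs_derivTail_le {χ C r t : ℝ} {K : ℕ} (hC : 0 ≤ C) (hr0 : 0 ≤ r) (hr1 : r < 1)
    (ht0 : 0 ≤ t) (ht1 : t ≤ 1)
    (hb : ∀ j, K + 1 ≤ j → |frobCoeff 1 χ j| ≤ C * r ^ j) :
    |∑' k, (((k + K : ℕ) : ℝ) + 1) * frobCoeff 1 χ (k + K + 1) * t ^ (k + K)|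
      ≤ C * r ^ (K + 1) * (((K : ℝ) + 1) / (1 - r) + r / (1 - r) ^ 2) := by
  have ht' : |t| < 2 := by rw [abs_of_nonneg ht0]; linarith
  set f : ℕ → ℝ := fun k ↦ ((k : ℝ) + 1) * frobCoeff 1 χ (k + 1) * t ^ k with hf
  have hsK : Summable fun k ↦ f (k + K) := (summable_nat_add_iff K).mpr (summable_derivSeries χ ht')
  have hfK : ∀ k, f (k + K) = (((k + K : ℕ) : ℝ) + 1) * frobCoeff 1 χ (k + K + 1) * t ^ (k + K) := by
    intro k; simp only [hf]
  have hrn : ‖r‖ < 1 := by rw [Real.norm_of_nonneg hr0]; exact hr1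
  -- the majorant g k = C r^{K+1} ((k : ℝ) r^k + (K+1) r^k)
  have hg1 : Summable fun k : ℕ ↦ (k : ℝ) * r ^ k := by
    simpa using summable_pow_mul_geometric_of_norm_lt_one 1 hrn
  have hg2 : Summable fun k : ℕ ↦ r ^ k := summable_geometric_of_lt_one hr0 hr1
  have hg : Summable fun k : ℕ ↦ C * r ^ (K + 1) * ((k : ℝ) * r ^ k + ((K : ℝ) + 1) * r ^ k) :=
    (hg1.add (hg2.mul_left _)).mul_left _
  have hbound : ∀ k, |f (k + K)| ≤ C * r ^ (K + 1) * ((k : ℝ) * r ^ k + ((K : ℝ) + 1) * r ^ k) := by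
    intro k
    rw [hfK, abs_mul, abs_mul, abs_pow, abs_of_nonneg ht0,
      abs_of_nonneg (by positivity : (0:ℝ) ≤ ((k + K : ℕ) : ℝ) + 1)]
    have h1 := hb (k + K + 1) (by omega)
    have htk : t ^ (k + K) ≤ 1 := pow_le_one₀ ht0 ht1
    have hkk : (((k + K : ℕ) : ℝ) + 1) = (k : ℝ) + ((K : ℝ) + 1) := by push_cast; ring
    calc (((k + K : ℕ) : ℝ) + 1) * |frobCoeff 1 χ (k + K + 1)| * t ^ (k + K)
        ≤ (((k + K : ℕ) : ℝ) + 1) * (C * r ^ (k + K + 1)) * 1 := by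
          gcongr
      _ = C * r ^ (K + 1) * ((k : ℝ) * r ^ k + ((K : ℝ) + 1) * r ^ k) := by
          rw [hkk, show k + K + 1 = k + (K + 1) by omega, pow_add]; ring
  calc |∑' k, (((k + K : ℕ) : ℝ) + 1) * frobCoeff 1 χ (k + K + 1) * t ^ (k + K)|
      = |∑' k, f (k + K)| := by simp only [hfK]
    _ ≤ ∑' k, |f (k + K)| := by
        have h := norm_tsum_le_tsum_norm hsK.norm
        simpa only [Real.norm_eq_abs] using h
    _ ≤ ∑' k : ℕ, C * r ^ (K + 1) * ((k : ℝ) * r ^ k + ((K : ℝ) + 1) * r ^ k) :=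
        hsK.abs.tsum_le_tsum hbound hg
    _ = C * r ^ (K + 1) * (∑' k : ℕ, (k : ℝ) * r ^ k + ((K : ℝ) + 1) * ∑' k : ℕ, r ^ k) := by
        rw [tsum_mul_left, (hg1.hasSum.add (hg2.mul_left _).hasSum).tsum_eq, tsum_mul_left]
    _ = C * r ^ (K + 1) * (((K : ℝ) + 1) / (1 - r) + r / (1 - r) ^ 2) := by
        rw [tsum_coe_mul_geometric_of_norm_lt_one hrn, tsum_geometric_of_lt_one hr0 hr1]
        ring

/-! ### Coefficient lists and their Horner evaluation -/

open Literature.Analysis.ValidatedNumerics.PolyMP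

/-- `evalR (as ++ bs) x = evalR as x + x^{|as|} · evalR bs x`. [folklore] -/
private theorem evalR_append : ∀ (as bs : List ℝ) (x : ℝ),
    evalR (as ++ bs) x = evalR as x + x ^ as.length * evalR bs x
  | [], bs, x => by simp
  | a :: as, bs, x => by
      rw [List.cons_append, evalR_cons, evalR_cons, evalR_append as bs x, List.length_cons, pow_succ]
      ring

/-- The Horner evaluation of the mapped range is the finite power sum. [folklore] -/
private theorem evalR_map_range (f : ℕ → ℝ) (x : ℝ) :
    ∀ n : ℕ, evalR ((List.range n).map f) x = ∑ j ∈ Finset.range n, f j * x ^ j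
  | 0 => by simp
  | n + 1 => by
      rw [List.range_succ, List.map_append, evalR_append, evalR_map_range f x n,
        Finset.sum_range_succ, List.length_map, List.length_range]
      simp [evalR_cons, mul_comm]

/-- The list `[a_0, …, a_{N−1}]` of the first `N` Frobenius coefficients at `λ = 1`.
[cite: CoddingtonLevinson1955, Ch. 4 §8] -/
def coeffList (χ : ℝ) (N : ℕ) : List ℝ := (List.range N).map fun j : ℕ ↦ frobCoeff 1 χ j

/-- The list `[1·a_1, 2·a_2, …, K·a_K]` (coefficients of the derivative series).
[cite: CoddingtonLevinson1955, Ch. 4 §8] -/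
def derivList (χ : ℝ) (K : ℕ) : List ℝ :=
  (List.range K).map fun k : ℕ ↦ ((k : ℝ) + 1) * frobCoeff 1 χ (k + 1)

/-- `u_χ(1 − t) = P_N(t) + (tail)`. [cite: CoddingtonLevinson1955, Ch. 4 §8] -/
theorem frobSol_eq_evalR_add (χ : ℝ) {t : ℝ} (ht : |t| < 2) (N : ℕ) :
    frobSol 1 χ (1 - t) = evalR (coeffList χ N) t + ∑' j, frobCoeff 1 χ (j + N) * t ^ (j + N) := by
  rw [frobSol_split χ ht N, coeffList, evalR_map_range]

/-- `u′_χ(1 − t) = −(D_K(t) + (tail))`. [cite: CoddingtonLevinson1955, Ch. 4 §8] -/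
theorem frobSol₁_eq_evalR_add (χ : ℝ) {t : ℝ} (ht : |t| < 2) (K : ℕ) :
    frobSol₁ 1 χ (1 - t) = -(evalR (derivList χ K) t
      + ∑' k, (((k + K : ℕ) : ℝ) + 1) * frobCoeff 1 χ (k + K + 1) * t ^ (k + K)) := by
  rw [frobSol₁_split χ ht K, derivList, evalR_map_range]

/-! ### Kernel side: interval enclosures of the coefficients (`MI` arithmetic at scale `S`) -/

open Literature.Analysis.ValidatedNumerics.NumericsMP

/-- Mathlib's twenty-digit lower bound for `π`, as a rational. [cite: Moore1979, Sect. 2.2 (2.16)–(2.21)] -/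
def piLoQ : ℚ := 3.14159265358979323846

/-- Mathlib's twenty-digit upper bound for `π`, as a rational. [cite: Moore1979, Sect. 2.2 (2.16)–(2.21)] -/
def piHiQ : ℚ := 3.14159265358979323847

/-- The interval `[piLoQ, piHiQ] ∋ π` at scale `S`. [cite: Moore1979, Sect. 2.2 (2.16)–(2.21)] -/
def piI (S : ℕ) : MI := MI.span (ofRat S piLoQ) (ofRat S piHiQ)

/-- `π ∈ piI S` (from `Real.pi_gt_d20`, `Real.pi_lt_d20`). [cite: Moore1979, Sect. 2.2 (2.16)–(2.21)] -/
theorem mem_piI (S : ℕ) : MI.mem S Real.pi (piI S) := by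
  refine MI.mem_span (mem_ofRat S piLoQ) (mem_ofRat S piHiQ) ?_ ?_
  · have h := Real.pi_gt_d20
    have e : ((piLoQ : ℚ) : ℝ) = 3.14159265358979323846 := by norm_num [piLoQ]
    rw [e]; exact h.le
  · have h := Real.pi_lt_d20
    have e : ((piHiQ : ℚ) : ℝ) = 3.14159265358979323847 := by norm_num [piHiQ]
    rw [e]; exact h.le

/-- The interval `4π²` at scale `S`. [cite: Moore1979, Sect. 2.2 (2.16)–(2.21)] -/
def pi2x4 (S : ℕ) : MI := (MI.sqr S (piI S)).mulInt 4

/-- The interval `8π²` at scale `S`. [cite: Moore1979, Sect. 2.2 (2.16)–(2.21)] -/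
def pi2x8 (S : ℕ) : MI := (MI.sqr S (piI S)).mulInt 8

/-- `4π² ∈ pi2x4 S`. [cite: Moore1979, Sect. 2.2 (2.16)–(2.21)] -/
theorem mem_pi2x4 {S : ℕ} (hS : 0 < S) : MI.mem S (4 * π ^ 2) (pi2x4 S) := by
  have h := MI.mem_mulInt (MI.mem_sqr hS (mem_piI S)) 4
  rw [show (4 : ℝ) * π ^ 2 = π ^ 2 * ((4 : ℤ) : ℝ) by push_cast; ring]
  exact h

/-- `8π² ∈ pi2x8 S`. [cite: Moore1979, Sect. 2.2 (2.16)–(2.21)] -/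
theorem mem_pi2x8 {S : ℕ} (hS : 0 < S) : MI.mem S (8 * π ^ 2) (pi2x8 S) := by
  have h := MI.mem_mulInt (MI.mem_sqr hS (mem_piI S)) 8
  rw [show (8 : ℝ) * π ^ 2 = π ^ 2 * ((8 : ℤ) : ℝ) by push_cast; ring]
  exact h

/-- One step of the interval four-term recursion (the new coefficient `a_{k+1}` from the window
`(a_{k−2}, a_{k−1}, a_k)`), for the parameter interval `X ∋ χ`. [cite: CoddingtonLevinson1955, Ch. 4 §8] -/
def stepI (S : ℕ) (X : MI) (k : ℕ) (a2 a1 a0 : MI) : MI :=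
  MI.divNat
    (MI.add (MI.sub (MI.mul S (MI.add (MI.sub (MI.ofInt S ((k : ℤ) * ((k : ℤ) + 1))) X) (pi2x4 S)) a0)
      (MI.mul S (pi2x8 S) a1)) (MI.mul S (pi2x4 S) a2))
    (2 * (k + 1) ^ 2)

/-- The interval triples `(A_{k−2}, A_{k−1}, A_k)` enclosing the Frobenius coefficient triples
(structural recursion; the `match` evaluates the previous triple once).
[cite: CoddingtonLevinson1955, Ch. 4 §8] -/
def tripleI (S : ℕ) (X : MI) : ℕ → MI × MI × MI
  | 0 => (MI.ofInt S 0, MI.ofInt S 0, MI.ofInt S 1)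
  | k + 1 =>
    match tripleI S X k with
    | (a2, a1, a0) => (a1, a0, stepI S X k a2 a1 a0)

/-- Unfolding of the successor case. [folklore] -/
private theorem tripleI_succ (S : ℕ) (X : MI) (k : ℕ) :
    tripleI S X (k + 1) = ((tripleI S X k).2.1, (tripleI S X k).2.2,
      stepI S X k (tripleI S X k).1 (tripleI S X k).2.1 (tripleI S X k).2.2) := by
  rw [tripleI]

/-- **Inclusion of the coefficient triples.** [cite: CoddingtonLevinson1955, Ch. 4 §8] -/
theorem mem_tripleI {S : ℕ} (hS : 0 < S) {χ : ℝ} {X : MI} (hχ : MI.mem S χ X) :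
    ∀ k : ℕ, MI.mem S (frobTriple 1 χ k).1 (tripleI S X k).1 ∧
      MI.mem S (frobTriple 1 χ k).2.1 (tripleI S X k).2.1 ∧
      MI.mem S (frobTriple 1 χ k).2.2 (tripleI S X k).2.2
  | 0 => by
      simp only [frobTriple, tripleI]
      refine ⟨?_, ?_, ?_⟩
      · simpa using MI.mem_ofInt S 0
      · simpa using MI.mem_ofInt S 0
      · simpa using MI.mem_ofInt S 1
  | k + 1 => by
      obtain ⟨h2, h1, h0⟩ := mem_tripleI hS hχ k
      rw [tripleI_succ]
      refine ⟨h1, h0, ?_⟩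
      -- the third component is `frobCoeff 1 χ (k+1)`
      have e3 : (frobTriple 1 χ (k + 1)).2.2 = frobCoeff 1 χ (k + 1) := rfl
      rw [e3, frobCoeff_succ_one]
      have ea : frobCoeff 1 χ k = (frobTriple 1 χ k).2.2 := rfl
      have eb : frobPrev 1 χ k = (frobTriple 1 χ k).2.1 := rfl
      have ec : frobPrev₂ 1 χ k = (frobTriple 1 χ k).1 := rfl
      rw [ea, eb, ec]
      have hc : MI.mem S ((((k : ℤ) * ((k : ℤ) + 1) : ℤ) : ℝ) - χ + 4 * π ^ 2)
          (MI.add (MI.sub (MI.ofInt S ((k : ℤ) * ((k : ℤ) + 1))) X) (pi2x4 S)) :=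
        MI.mem_add (MI.mem_sub (MI.mem_ofInt S _) hχ) (mem_pi2x4 hS)
      have hnum := MI.mem_add (MI.mem_sub (MI.mem_mul hS hc h0) (MI.mem_mul hS (mem_pi2x8 hS) h1))
        (MI.mem_mul hS (mem_pi2x4 hS) h2)
      have hdiv := MI.mem_divNat hnum (n := 2 * (k + 1) ^ 2) (by positivity)
      have e : (((k : ℝ) * ((k : ℝ) + 1) - χ + 4 * π ^ 2) * (frobTriple 1 χ k).2.2
            - 8 * π ^ 2 * (frobTriple 1 χ k).2.1 + 4 * π ^ 2 * (frobTriple 1 χ k).1)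
            / (2 * ((k : ℝ) + 1) ^ 2)
          = (((((k : ℤ) * ((k : ℤ) + 1) : ℤ) : ℝ) - χ + 4 * π ^ 2) * (frobTriple 1 χ k).2.2
            - 8 * π ^ 2 * (frobTriple 1 χ k).2.1 + 4 * π ^ 2 * (frobTriple 1 χ k).1)
            / ((2 * (k + 1) ^ 2 : ℕ) : ℝ) := by
        push_cast; ring
      rw [e]
      exact hdiv

open Literature.Analysis.ValidatedNumerics.PolyMP in
/-- Coefficientwise inclusion of mapped ranges. [folklore] -/
private theorem pmem_map_range' {S : ℕ} :
    ∀ (n k : ℕ) {f : ℕ → ℝ} {F : ℕ → MI}, (∀ j, MI.mem S (f j) (F j)) →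
      PMem S ((List.range' k n).map f) ((List.range' k n).map F)
  | 0, _, _, _, _ => by simpa using pmem_nil S
  | n + 1, k, f, F, h => by
      rw [List.range'_succ, List.map_cons, List.map_cons]
      exact pmem_cons (h k) (pmem_map_range' n (k + 1) h)

/-- The interval coefficients `[A_k, …, A_{k+n−1}]` in ONE pass from the triple at `k`. [cite: Moore1979, Sect. 2.2 (2.16)–(2.21)] -/
def coeffsFrom (S : ℕ) (X : MI) : ℕ → ℕ → MI × MI × MI → IPoly
  | 0, _, _ => []
  | n + 1, k, (a2, a1, a0) => a0 :: coeffsFrom S X n (k + 1) (a1, a0, stepI S X k a2 a1 a0)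

/-- The derivative coefficients `[k·A_k, …]` in one pass from the triple at `k`. [cite: Moore1979, Sect. 2.2 (2.16)–(2.21)] -/
def derivsFrom (S : ℕ) (X : MI) : ℕ → ℕ → MI × MI × MI → IPoly
  | 0, _, _ => []
  | n + 1, k, (a2, a1, a0) => a0.mulInt (k : ℤ) :: derivsFrom S X n (k + 1) (a1, a0, stepI S X k a2 a1 a0)

/-- `coeffsFrom` lists the third components of the successive triples. [folklore] -/
private theorem coeffsFrom_eq (S : ℕ) (X : MI) :
    ∀ n k : ℕ, coeffsFrom S X n k (tripleI S X k) = (List.range' k n).map fun j ↦ (tripleI S X j).2.2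
  | 0, k => by simp [coeffsFrom]
  | n + 1, k => by
      rw [List.range'_succ, List.map_cons, ← coeffsFrom_eq S X n (k + 1), tripleI_succ]
      rfl

/-- `derivsFrom` lists `j · A_j`. [folklore] -/
private theorem derivsFrom_eq (S : ℕ) (X : MI) :
    ∀ n k : ℕ, derivsFrom S X n k (tripleI S X k) =
      (List.range' k n).map fun j ↦ ((tripleI S X j).2.2).mulInt (j : ℤ)
  | 0, k => by simp [derivsFrom]
  | n + 1, k => by
      rw [List.range'_succ, List.map_cons, ← derivsFrom_eq S X n (k + 1), tripleI_succ]
      rfl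

/-- The interval coefficient list `[A_0, …, A_{N−1}]`. [cite: CoddingtonLevinson1955, Ch. 4 §8] -/
def coeffsI (S : ℕ) (X : MI) (N : ℕ) : IPoly :=
  coeffsFrom S X N 0 (MI.ofInt S 0, MI.ofInt S 0, MI.ofInt S 1)

/-- The interval derivative-coefficient list `[1·A_1, …, K·A_K]`. [cite: CoddingtonLevinson1955, Ch. 4 §8] -/
def derivsI (S : ℕ) (X : MI) (K : ℕ) : IPoly :=
  derivsFrom S X K 1 (tripleI S X 1)

/-- Inclusion of the coefficient list. [cite: CoddingtonLevinson1955, Ch. 4 §8] -/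
theorem pmem_coeffsI {S : ℕ} (hS : 0 < S) {χ : ℝ} {X : MI} (hχ : MI.mem S χ X) (N : ℕ) :
    PMem S (coeffList χ N) (coeffsI S X N) := by
  have h := coeffsFrom_eq S X N 0
  rw [show tripleI S X 0 = (MI.ofInt S 0, MI.ofInt S 0, MI.ofInt S 1) from rfl] at h
  unfold coeffsI
  rw [h, coeffList, List.range_eq_range']
  exact pmem_map_range' N 0 fun j ↦ (mem_tripleI hS hχ j).2.2

/-- Inclusion of the derivative-coefficient list. [cite: CoddingtonLevinson1955, Ch. 4 §8] -/
theorem pmem_derivsI {S : ℕ} (hS : 0 < S) {χ : ℝ} {X : MI} (hχ : MI.mem S χ X) (K : ℕ) :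
    PMem S (derivList χ K) (derivsI S X K) := by
  unfold derivsI
  rw [derivsFrom_eq, derivList]
  -- reindex: range K ↦ k+1 over range' 1 K
  have e : (List.range K).map (fun k : ℕ ↦ ((k : ℝ) + 1) * frobCoeff 1 χ (k + 1))
      = (List.range' 1 K).map (fun j : ℕ ↦ ((j : ℝ)) * frobCoeff 1 χ j) := by
    rw [List.range'_eq_map_range, List.map_map]
    congr 1
    funext k
    show ((k : ℝ) + 1) * frobCoeff 1 χ (k + 1) = (((1 + k : ℕ) : ℝ)) * frobCoeff 1 χ (1 + k)
    rw [Nat.add_comm 1 k]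
    push_cast
    ring
  rw [e]
  refine pmem_map_range' K 1 fun j ↦ ?_
  have h := MI.mem_mulInt (mem_tripleI hS hχ j).2.2 (j : ℤ)
  have e2 : (j : ℝ) * frobCoeff 1 χ j = (frobTriple 1 χ j).2.2 * ((j : ℤ) : ℝ) := by
    push_cast; rw [mul_comm]; rfl
  rw [e2]; exact h

/-! ### Kernel side: point values, moments (integrals of polynomials) and sup bounds -/

open Literature.Analysis.ValidatedNumerics.PolyMP

/-- The enclosure of `P(c)`: the constant coefficient of the Taylor shift of `P` to `c`. [cite: Moore1979, Sect. 2.2 (2.16)–(2.21)] -/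
def evalAtI (S : ℕ) (P : IPoly) (C : MI) : MI :=
  match shiftI S P C with
  | [] => ⟨0, 0⟩
  | s :: _ => s

/-- `evalR as c ∈ evalAtI S P C` for `as ∈ P`, `c ∈ C`. [cite: Moore1979, Sect. 2.2 (2.16)–(2.21)] -/
theorem mem_evalAtI {S : ℕ} (hS : 0 < S) {as : List ℝ} {P : IPoly} (h : PMem S as P) {c : ℝ} {C : MI}
    (hc : MI.mem S c C) : MI.mem S (evalR as c) (evalAtI S P C) := by
  have hsh := pmem_shiftI hS hc h
  have hev : evalR as c = evalR (shiftR as c) 0 := by rw [evalR_shiftR, add_zero]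
  rw [hev]
  unfold evalAtI
  generalize shiftR as c = SR at hsh
  generalize shiftI S P C = SP at hsh
  match SR, SP, hsh with
  | [], [], _ => simp [MI.mem]
  | a :: tl, s :: tl', List.Forall₂.cons ha _ => simpa using ha

/-- Interval Horner evaluation `P(c)` (linear cost; for point values). [cite: Moore1979, Sect. 2.2 (2.16)–(2.21)] -/
def hornerI (S : ℕ) : IPoly → MI → MI
  | [], _ => ⟨0, 0⟩
  | I :: P, C => MI.add I (MI.mul S C (hornerI S P C))

/-- `evalR as c ∈ hornerI S P C`. [cite: Moore1979, Sect. 2.2 (2.16)–(2.21)] -/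
theorem mem_hornerI {S : ℕ} (hS : 0 < S) {c : ℝ} {C : MI} (hc : MI.mem S c C) :
    ∀ {as : List ℝ} {P : IPoly}, PMem S as P → MI.mem S (evalR as c) (hornerI S P C)
  | _, _, List.Forall₂.nil => by simp [hornerI, MI.mem]
  | _, _, List.Forall₂.cons (a := a) (b := I) ha hP => by
      simp only [evalR_cons, hornerI]
      exact MI.mem_add ha (MI.mem_mul hS hc (mem_hornerI hS hc hP))

/-- Moments of a coefficient list: `momR m as = Σ_i as_i/(m+i+1) = ∫_0^1 t^m P(t) dt`. [cite: Moore1979, Sect. 2.2 (2.16)–(2.21)] -/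
noncomputable def momR : ℕ → List ℝ → ℝ
  | _, [] => 0
  | m, a :: as => a / ((m : ℝ) + 1) + momR (m + 1) as

/-- Interval moments. [cite: Moore1979, Sect. 2.2 (2.16)–(2.21)] -/
def momI : ℕ → IPoly → MI
  | _, [] => ⟨0, 0⟩
  | m, I :: P => MI.add (MI.divNat I (m + 1)) (momI (m + 1) P)

/-- Inclusion of the moments. [cite: Moore1979, Sect. 2.2 (2.16)–(2.21)] -/
theorem mem_momI {S : ℕ} : ∀ (m : ℕ) {as : List ℝ} {P : IPoly}, PMem S as P → MI.mem S (momR m as) (momI m P)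
  | m, _, _, List.Forall₂.nil => by simp [momR, momI, MI.mem]
  | m, _, _, List.Forall₂.cons (a := a) (b := I) ha hP => by
      simp only [momR, momI]
      have h1 := MI.mem_divNat ha (n := m + 1) (Nat.succ_pos m)
      have e : a / ((m : ℝ) + 1) = a / ((m + 1 : ℕ) : ℝ) := by push_cast; rfl
      rw [e]
      exact MI.mem_add h1 (mem_momI (m + 1) hP)

/-- Horner evaluation is continuous. [folklore] -/
private theorem continuous_evalR : ∀ as : List ℝ, Continuous (evalR as)
  | [] => by
      change Continuous fun _ : ℝ ↦ (0 : ℝ)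
      exact continuous_const
  | a :: as => by
      have h : Continuous fun x ↦ a + x * evalR as x := continuous_const.add (continuous_id.mul (continuous_evalR as))
      exact h

/-- `∫_0^1 t^m P(t) dt = momR m as`. [cite: Moore1979, Sect. 2.2 (2.16)–(2.21)] -/
theorem integral_pow_mul_evalR : ∀ (as : List ℝ) (m : ℕ),
    ∫ t in (0:ℝ)..1, t ^ m * evalR as t = momR m as
  | [], m => by simp [momR]
  | a :: as, m => by
      have ih := integral_pow_mul_evalR as (m + 1)
      simp only [evalR_cons, momR]
      have e : (fun t : ℝ ↦ t ^ m * (a + t * evalR as t)) = fun t ↦ a * t ^ m + t ^ (m + 1) * evalR as t := by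
        funext t; ring
      rw [e]
      have hi1 : IntervalIntegrable (fun t : ℝ ↦ a * t ^ m) volume 0 1 :=
        (continuous_const.mul (continuous_pow m)).intervalIntegrable _ _
      have hi2 : IntervalIntegrable (fun t : ℝ ↦ t ^ (m + 1) * evalR as t) volume 0 1 :=
        ((continuous_pow (m + 1)).mul (continuous_evalR as)).intervalIntegrable _ _
      rw [intervalIntegral.integral_add hi1 hi2, ih, intervalIntegral.integral_const_mul, integral_pow]
      simp
      ring

/-- `∫_0^1 P(t) dt = momR 0 as`. [cite: Moore1979, Sect. 2.2 (2.16)–(2.21)] -/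
theorem integral_evalR (as : List ℝ) : ∫ t in (0:ℝ)..1, evalR as t = momR 0 as := by
  have h := integral_pow_mul_evalR as 0
  simpa using h

/-- `|P(t)| ≤ absBoundI/S` on `[−1, 1]`. [cite: Moore1979, Sect. 2.2 (2.16)–(2.21)] -/
theorem abs_evalR_le_absBoundI {S : ℕ} (hS : 0 < S) {as : List ℝ} {P : IPoly} (h : PMem S as P)
    {t : ℝ} (ht : |t| ≤ 1) : |evalR as t| * S ≤ (absBoundI S 1 1 P : ℝ) := by
  have h1 := abs_evalR_le_absBoundR as (h := 1) ht
  have h2 := absBoundR_le_absBoundI (S := S) (hn := 1) (hd := 1) zero_le_one one_pos h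
  simp only [Int.cast_one, Nat.cast_one, div_one] at h2
  have hSr : (0 : ℝ) < S := by exact_mod_cast hS
  nlinarith

/-! ### Kernel side: the majorant constant and the two tail radii -/

open Literature.Analysis.ValidatedNumerics

/-- The scaled majorant constant `C·S := max_{i ∈ {J, J+1, J+2}} ⌈|A_i|_hi · 4^i / 3^i⌉`, so that
`|a_i| ≤ C (3/4)^i` on the window. [cite: Johansson2019, Sect. 4.1 Thm. 1] -/
def cmajS (S : ℕ) (X : MI) (J : ℕ) : ℤ :=
  max (max (Numerics.cdiv ((tripleI S X J).2.2.absHi * 4 ^ J) (3 ^ J))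
    (Numerics.cdiv ((tripleI S X (J + 1)).2.2.absHi * 4 ^ (J + 1)) (3 ^ (J + 1))))
    (Numerics.cdiv ((tripleI S X (J + 2)).2.2.absHi * 4 ^ (J + 2)) (3 ^ (J + 2)))

/-- Scaled upper bound `ρ·S` of the value tail `4 C (3/4)^N`, `N = J + 3`. [cite: Johansson2019, Sect. 4.1 Thm. 1] -/
def rhoS (S : ℕ) (X : MI) (J : ℕ) : ℤ :=
  Numerics.cdiv (cmajS S X J * 4 * 3 ^ (J + 3)) (4 ^ (J + 3))

/-- Scaled upper bound `ρ′·S` of the derivative tail `4 C (3/4)^N (N + 3)`, `N = J + 3`. [cite: Johansson2019, Sect. 4.1 Thm. 1] -/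
def rhodS (S : ℕ) (X : MI) (J : ℕ) : ℤ :=
  Numerics.cdiv (cmajS S X J * 4 * ((J : ℤ) + 6) * 3 ^ (J + 3)) (4 ^ (J + 3))

/-- The window bound: `|a_i| ≤ (cmajS/S) (3/4)^i` for `i = J, J+1, J+2`. [cite: CoddingtonLevinson1955, Ch. 4 §8] -/
theorem window_bound {S : ℕ} (hS : 0 < S) {χ : ℝ} {X : MI} (hχ : MI.mem S χ X) (J : ℕ) :
    ∀ i ∈ ({J, J + 1, J + 2} : Finset ℕ),
      |frobCoeff 1 χ i| ≤ (cmajS S X J : ℝ) / S * (3 / 4 : ℝ) ^ i := by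
  have hSr : (0 : ℝ) < S := by exact_mod_cast hS
  -- generic step: from `cdiv (absHi * 4^i) (3^i) ≤ cmaj`
  have step : ∀ i : ℕ, Numerics.cdiv ((tripleI S X i).2.2.absHi * 4 ^ i) (3 ^ i) ≤ cmajS S X J →
      |frobCoeff 1 χ i| ≤ (cmajS S X J : ℝ) / S * (3 / 4 : ℝ) ^ i := by
    intro i hi
    have hm : MI.mem S (frobCoeff 1 χ i) (tripleI S X i).2.2 := (mem_tripleI hS hχ i).2.2
    have h1 := MI.abs_le_absHi hm
    have h3pos : (0 : ℤ) < 3 ^ i := by positivity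
    have h2 := Numerics.le_cdiv_mul_real (a := (tripleI S X i).2.2.absHi * 4 ^ i) h3pos
    have hiR : ((Numerics.cdiv ((tripleI S X i).2.2.absHi * 4 ^ i) (3 ^ i) : ℤ) : ℝ) ≤ (cmajS S X J : ℝ) := by
      exact_mod_cast hi
    push_cast at h2
    have h4pos : (0 : ℝ) < (4 : ℝ) ^ i := by positivity
    have h3posR : (0 : ℝ) < (3 : ℝ) ^ i := by positivity
    -- |a_i| * S * 4^i ≤ absHi * 4^i ≤ cdiv * 3^i ≤ cmaj * 3^i
    have key : |frobCoeff 1 χ i| * S * (4 : ℝ) ^ i ≤ (cmajS S X J : ℝ) * (3 : ℝ) ^ i := by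
      nlinarith [mul_le_mul_of_nonneg_right h1 h4pos.le, mul_le_mul_of_nonneg_right hiR h3posR.le]
    have hpos : (0 : ℝ) < (S : ℝ) * (4 : ℝ) ^ i := by positivity
    calc |frobCoeff 1 χ i| = (|frobCoeff 1 χ i| * S * (4 : ℝ) ^ i) / ((S : ℝ) * (4 : ℝ) ^ i) := by
          field_simp
      _ ≤ ((cmajS S X J : ℝ) * (3 : ℝ) ^ i) / ((S : ℝ) * (4 : ℝ) ^ i) :=
          div_le_div_of_nonneg_right key hpos.le
      _ = (cmajS S X J : ℝ) / S * (3 / 4 : ℝ) ^ i := by rw [div_pow]; field_simp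
  intro i hi
  simp only [Finset.mem_insert, Finset.mem_singleton] at hi
  rcases hi with rfl | rfl | rfl
  · exact step _ ((le_max_left _ _).trans (le_max_left _ _))
  · exact step _ ((le_max_right _ _).trans (le_max_left _ _))
  · exact step _ (le_max_right _ _)

/-- From the window bound and the propagation condition at `J`: `|a_j| ≤ (cmajS/S)(3/4)^j` for all
`j ≥ J`. [cite: CoddingtonLevinson1955, Ch. 4 §8] -/
theorem geom_bound {S : ℕ} (hS : 0 < S) {χ M : ℝ} {X : MI} (hχ : MI.mem S χ X) {J : ℕ}
    (hM : |4 * π ^ 2 - χ| ≤ M) (hcond : Cond M (3 / 4) J) :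
    ∀ j, J ≤ j → |frobCoeff 1 χ j| ≤ (cmajS S X J : ℝ) / S * (3 / 4 : ℝ) ^ j := by
  have hw := window_bound hS hχ J
  exact frobCoeff_geom hM (by norm_num) hcond (hw J (by simp)) (hw (J + 1) (by simp)) (hw (J + 2) (by simp))

/-- `0 ≤ cmajS`. [folklore] -/
private theorem cmajS_nonneg {S : ℕ} (hS : 0 < S) {χ : ℝ} {X : MI} (hχ : MI.mem S χ X) (J : ℕ) :
    (0 : ℝ) ≤ (cmajS S X J : ℝ) / S := by
  have h := window_bound hS hχ J J (by simp)
  have hSr : (0 : ℝ) < S := by exact_mod_cast hS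
  have h34 : (0 : ℝ) < (3 / 4 : ℝ) ^ J := by positivity
  exact (mul_nonneg_iff_of_pos_right h34).mp ((abs_nonneg _).trans h)

/-- **The value tail on `[0, 1]`:** `|u_χ(1 − t) − P(t)| ≤ rhoS/S`, `P` = the first `J + 3` terms.
[cite: CoddingtonLevinson1955, Ch. 4 §8] -/
theorem value_remainder_le {S : ℕ} (hS : 0 < S) {χ M : ℝ} {X : MI} (hχ : MI.mem S χ X) {J : ℕ}
    (hM : |4 * π ^ 2 - χ| ≤ M) (hcond : Cond M (3 / 4) J) {t : ℝ} (ht0 : 0 ≤ t) (ht1 : t ≤ 1) :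
    |frobSol 1 χ (1 - t) - evalR (coeffList χ (J + 3)) t| * S ≤ (rhoS S X J : ℝ) := by
  have hSr : (0 : ℝ) < S := by exact_mod_cast hS
  have ht' : |t| < 2 := by rw [abs_of_nonneg ht0]; linarith
  rw [frobSol_eq_evalR_add χ ht' (J + 3), add_sub_cancel_left]
  have hg := geom_bound hS hχ hM hcond
  have htail := abs_valueTail_le (N := J + 3) (C := (cmajS S X J : ℝ) / S) (r := 3 / 4)
    (by norm_num) (by norm_num) ht0 ht1 (fun j hj ↦ hg j (by omega))
  have h4pos : (0 : ℤ) < 4 ^ (J + 3) := by positivity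
  have hc := Numerics.le_cdiv_mul_real (a := cmajS S X J * 4 * 3 ^ (J + 3)) h4pos
  unfold rhoS
  push_cast at hc ⊢
  have h4R : (0 : ℝ) < (4 : ℝ) ^ (J + 3) := by positivity
  have e : (cmajS S X J : ℝ) / S * (3 / 4 : ℝ) ^ (J + 3) / (1 - 3 / 4)
      = (cmajS S X J : ℝ) * 4 * (3 : ℝ) ^ (J + 3) / ((4 : ℝ) ^ (J + 3)) / S := by
    rw [div_pow]; field_simp; ring
  rw [e] at htail
  have := (le_div_iff₀ hSr).mp htail
  calc _ ≤ (cmajS S X J : ℝ) * 4 * (3 : ℝ) ^ (J + 3) / (4 : ℝ) ^ (J + 3) := this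
    _ ≤ _ := by rw [div_le_iff₀ h4R]; exact hc

/-- **The derivative tail on `[0, 1]`:** `|u′_χ(1 − t) + D(t)| ≤ rhodS/S`, `D` = the first `J + 2`
terms of the derivative series. [cite: CoddingtonLevinson1955, Ch. 4 §8] -/
theorem deriv_remainder_le {S : ℕ} (hS : 0 < S) {χ M : ℝ} {X : MI} (hχ : MI.mem S χ X) {J : ℕ}
    (hM : |4 * π ^ 2 - χ| ≤ M) (hcond : Cond M (3 / 4) J) {t : ℝ} (ht0 : 0 ≤ t) (ht1 : t ≤ 1) :
    |frobSol₁ 1 χ (1 - t) + evalR (derivList χ (J + 2)) t| * S ≤ (rhodS S X J : ℝ) := by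
  have hSr : (0 : ℝ) < S := by exact_mod_cast hS
  have ht' : |t| < 2 := by rw [abs_of_nonneg ht0]; linarith
  rw [frobSol₁_eq_evalR_add χ ht' (J + 2)]
  have e0 : -(evalR (derivList χ (J + 2)) t +
        ∑' k, (((k + (J + 2) : ℕ) : ℝ) + 1) * frobCoeff 1 χ (k + (J + 2) + 1) * t ^ (k + (J + 2)))
      + evalR (derivList χ (J + 2)) t
      = -∑' k, (((k + (J + 2) : ℕ) : ℝ) + 1) * frobCoeff 1 χ (k + (J + 2) + 1) * t ^ (k + (J + 2)) := by
    ring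
  rw [e0, abs_neg]
  have hg := geom_bound hS hχ hM hcond
  have hC := cmajS_nonneg hS hχ J
  have htail := abs_derivTail_le (K := J + 2) (C := (cmajS S X J : ℝ) / S) (r := 3 / 4)
    hC (by norm_num) (by norm_num) ht0 ht1 (fun j hj ↦ hg j (by omega))
  have h4pos : (0 : ℤ) < 4 ^ (J + 3) := by positivity
  have hc := Numerics.le_cdiv_mul_real (a := cmajS S X J * 4 * ((J : ℤ) + 6) * 3 ^ (J + 3)) h4pos
  unfold rhodS
  push_cast at hc
  have h4R : (0 : ℝ) < (4 : ℝ) ^ (J + 3) := by positivity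
  have e : (cmajS S X J : ℝ) / S * (3 / 4 : ℝ) ^ (J + 2 + 1) *
        ((((J + 2 : ℕ) : ℝ) + 1) / (1 - 3 / 4) + 3 / 4 / (1 - 3 / 4) ^ 2)
      = (cmajS S X J : ℝ) * 4 * ((J : ℝ) + 6) * (3 : ℝ) ^ (J + 3) / ((4 : ℝ) ^ (J + 3)) / S := by
    rw [div_pow, show J + 2 + 1 = J + 3 by omega]; push_cast; field_simp; ring
  rw [e] at htail
  have := (le_div_iff₀ hSr).mp htail
  calc _ ≤ (cmajS S X J : ℝ) * 4 * ((J : ℝ) + 6) * (3 : ℝ) ^ (J + 3) / (4 : ℝ) ^ (J + 3) := this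
    _ ≤ _ := by rw [div_le_iff₀ h4R]; exact hc

/-! ### Kernel side: certified signs of `u_χ` and `u′_χ` at rational points -/

/-- Shift the head of a real coefficient list by `δ`. [cite: Moore1979, Sect. 2.2 (2.16)–(2.21)] -/
noncomputable def shiftHead (δ : ℝ) : List ℝ → List ℝ
  | [] => []
  | a :: tl => (a + δ) :: tl

/-- Widen the head of an interval coefficient list by `e` (scaled). [cite: Moore1979, Sect. 2.2 (2.16)–(2.21)] -/
def widenHead (e : ℤ) : IPoly → IPoly
  | [] => []
  | I :: P => I.widen e :: P

/-- The value polynomial with its constant coefficient widened by the value-tail radius. [cite: Moore1979, Sect. 2.2 (2.16)–(2.21)] -/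
def valPolyW (S : ℕ) (X : MI) (J : ℕ) : IPoly := widenHead (rhoS S X J) (coeffsI S X (J + 3))

/-- The derivative polynomial with its constant coefficient widened by the derivative-tail radius.
[cite: Moore1979, Sect. 2.2 (2.16)–(2.21)] -/
def derPolyW (S : ℕ) (X : MI) (J : ℕ) : IPoly := widenHead (rhodS S X J) (derivsI S X (J + 2))

/-- Widening the constant coefficient absorbs a bounded remainder. [cite: Moore1979, Sect. 2.2 (2.16)–(2.21)] -/
theorem pmem_widenHead {S : ℕ} {as : List ℝ} {P : IPoly} (h : PMem S as P) {e : ℤ} {δ : ℝ}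
    (hδ : |δ| * S ≤ e) : PMem S (shiftHead δ as) (widenHead e P) := by
  cases h with
  | nil => exact pmem_nil S
  | cons ha htl =>
      simp only [shiftHead, widenHead]
      refine pmem_cons (MI.mem_widen ha ?_) htl
      simpa using hδ

/-- `evalR (shiftHead δ as) x = evalR as x + δ` for nonempty `as`. [folklore] -/
private theorem evalR_shiftHead (as : List ℝ) (δ x : ℝ) (hne : as ≠ []) :
    evalR (shiftHead δ as) x = evalR as x + δ := by
  cases as with
  | nil => exact absurd rfl hne
  | cons a tl => simp only [shiftHead, evalR_cons]; ring

/-- `coeffList χ (J+3)` is nonempty. [folklore] -/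
private theorem coeffList_ne_nil (χ : ℝ) (J : ℕ) : coeffList χ (J + 3) ≠ [] := by
  simp [coeffList]

/-- `derivList χ (J+2)` is nonempty. [folklore] -/
private theorem derivList_ne_nil (χ : ℝ) (J : ℕ) : derivList χ (J + 2) ≠ [] := by
  simp [derivList]

/-- **The widened value polynomial encloses `u_χ(1 − t)` itself** on `t ∈ [0,1]`: there is a real
coefficient list in `valPolyW` whose Horner value at `t` is exactly `u_χ(1 − t)`.
[cite: CoddingtonLevinson1955, Ch. 4 §8] -/
theorem exists_pmem_valPolyW {S : ℕ} (hS : 0 < S) {χ M : ℝ} {X : MI} (hχ : MI.mem S χ X) {J : ℕ}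
    (hM : |4 * π ^ 2 - χ| ≤ M) (hcond : Cond M (3 / 4) J) {t : ℝ} (ht0 : 0 ≤ t) (ht1 : t ≤ 1) :
    ∃ as : List ℝ, PMem S as (valPolyW S X J) ∧ evalR as t = frobSol 1 χ (1 - t) := by
  set δ := frobSol 1 χ (1 - t) - evalR (coeffList χ (J + 3)) t with hδ
  have hδb : |δ| * S ≤ (rhoS S X J : ℝ) := value_remainder_le hS hχ hM hcond ht0 ht1
  refine ⟨shiftHead δ (coeffList χ (J + 3)), pmem_widenHead (pmem_coeffsI hS hχ (J + 3)) hδb, ?_⟩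
  rw [evalR_shiftHead _ _ _ (coeffList_ne_nil χ J), hδ]; ring

/-- **The widened derivative polynomial encloses `−u′_χ(1 − t)`** on `t ∈ [0,1]`.
[cite: CoddingtonLevinson1955, Ch. 4 §8] -/
theorem exists_pmem_derPolyW {S : ℕ} (hS : 0 < S) {χ M : ℝ} {X : MI} (hχ : MI.mem S χ X) {J : ℕ}
    (hM : |4 * π ^ 2 - χ| ≤ M) (hcond : Cond M (3 / 4) J) {t : ℝ} (ht0 : 0 ≤ t) (ht1 : t ≤ 1) :
    ∃ as : List ℝ, PMem S as (derPolyW S X J) ∧ evalR as t = -frobSol₁ 1 χ (1 - t) := by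
  set δ := -frobSol₁ 1 χ (1 - t) - evalR (derivList χ (J + 2)) t with hδ
  have hδb : |δ| * S ≤ (rhodS S X J : ℝ) := by
    have h := deriv_remainder_le hS hχ hM hcond ht0 ht1
    rw [hδ, show -frobSol₁ 1 χ (1 - t) - evalR (derivList χ (J + 2)) t
      = -(frobSol₁ 1 χ (1 - t) + evalR (derivList χ (J + 2)) t) by ring, abs_neg]
    exact h
  refine ⟨shiftHead δ (derivList χ (J + 2)), pmem_widenHead (pmem_derivsI hS hχ (J + 2)) hδb, ?_⟩
  rw [evalR_shiftHead _ _ _ (derivList_ne_nil χ J), hδ]; ring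

/-- The `x`-cell `[1 − b, 1 − a]` of a `t`-cell `[a, b] ⊆ [0, 1]`: its points have `t = 1 − x ∈ [0,1]`
within `[a, b]`. [folklore] -/
private theorem tcell_of_xcell {a b : ℚ} (ha : 0 ≤ a) (hb : b ≤ 1) {x : ℝ}
    (hx : x ∈ Icc (1 - (b : ℝ)) (1 - a)) :
    0 ≤ 1 - x ∧ 1 - x ≤ 1 ∧ ((a : ℚ) : ℝ) ≤ 1 - x ∧ 1 - x ≤ ((b : ℚ) : ℝ) := by
  have ha' : (0 : ℝ) ≤ a := by exact_mod_cast ha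
  have hb' : ((b : ℚ) : ℝ) ≤ 1 := by exact_mod_cast hb
  obtain ⟨h1, h2⟩ := hx
  exact ⟨by linarith, by linarith, by linarith, by linarith⟩

/-- **Sign of `u_χ(x)` from the kernel:** `posOn` of the widened value polynomial on the `t`-cell
`[a, b]` gives `u_χ > 0` on the `x`-cell `[1 − b, 1 − a]` (`negOn`: `< 0`). [cite: Kearfott1987, Sect. 1; AlefeldMayer2000, Sect. 4] -/
theorem frobSol_pos_of_posOn {S : ℕ} (hS : 0 < S) {χ M : ℝ} {X : MI} (hχ : MI.mem S χ X) {J : ℕ}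
    (hM : |4 * π ^ 2 - χ| ≤ M) (hcond : Cond M (3 / 4) J) {d : ℕ} {a b : ℚ}
    (h : posOn S d (valPolyW S X J) a b = true) (hab : a ≤ b) (ha : 0 ≤ a) (hb : b ≤ 1)
    {x : ℝ} (hx : x ∈ Icc (1 - (b : ℝ)) (1 - a)) : 0 < frobSol 1 χ x := by
  obtain ⟨ht0, ht1, hta, htb⟩ := tcell_of_xcell ha hb hx
  obtain ⟨as, hmem, hev⟩ := exists_pmem_valPolyW hS hχ hM hcond ht0 ht1
  have hpos := posOn_sound hS h hab hmem hta htb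
  rw [hev, show (1 : ℝ) - (1 - x) = x by ring] at hpos
  exact hpos

/-- [cite: Kearfott1987, Sect. 1; AlefeldMayer2000, Sect. 4] -/
theorem frobSol_neg_of_negOn {S : ℕ} (hS : 0 < S) {χ M : ℝ} {X : MI} (hχ : MI.mem S χ X) {J : ℕ}
    (hM : |4 * π ^ 2 - χ| ≤ M) (hcond : Cond M (3 / 4) J) {d : ℕ} {a b : ℚ}
    (h : negOn S d (valPolyW S X J) a b = true) (hab : a ≤ b) (ha : 0 ≤ a) (hb : b ≤ 1)
    {x : ℝ} (hx : x ∈ Icc (1 - (b : ℝ)) (1 - a)) : frobSol 1 χ x < 0 := by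
  obtain ⟨ht0, ht1, hta, htb⟩ := tcell_of_xcell ha hb hx
  obtain ⟨as, hmem, hev⟩ := exists_pmem_valPolyW hS hχ hM hcond ht0 ht1
  have hneg := negOn_sound hS h hab hmem hta htb
  rw [hev, show (1 : ℝ) - (1 - x) = x by ring] at hneg
  exact hneg

/-- **Sign of `u′_χ(x)` from the kernel** (note the sign flip: `derPolyW` encloses `−u′`). [cite: Kearfott1987, Sect. 1; AlefeldMayer2000, Sect. 4] -/
theorem frobSol₁_neg_of_posOn {S : ℕ} (hS : 0 < S) {χ M : ℝ} {X : MI} (hχ : MI.mem S χ X) {J : ℕ}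
    (hM : |4 * π ^ 2 - χ| ≤ M) (hcond : Cond M (3 / 4) J) {d : ℕ} {a b : ℚ}
    (h : posOn S d (derPolyW S X J) a b = true) (hab : a ≤ b) (ha : 0 ≤ a) (hb : b ≤ 1)
    {x : ℝ} (hx : x ∈ Icc (1 - (b : ℝ)) (1 - a)) : frobSol₁ 1 χ x < 0 := by
  obtain ⟨ht0, ht1, hta, htb⟩ := tcell_of_xcell ha hb hx
  obtain ⟨as, hmem, hev⟩ := exists_pmem_derPolyW hS hχ hM hcond ht0 ht1
  have hpos := posOn_sound hS h hab hmem hta htb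
  rw [hev, show (1 : ℝ) - (1 - x) = x by ring] at hpos
  linarith

/-- [cite: Kearfott1987, Sect. 1; AlefeldMayer2000, Sect. 4] -/
theorem frobSol₁_pos_of_negOn {S : ℕ} (hS : 0 < S) {χ M : ℝ} {X : MI} (hχ : MI.mem S χ X) {J : ℕ}
    (hM : |4 * π ^ 2 - χ| ≤ M) (hcond : Cond M (3 / 4) J) {d : ℕ} {a b : ℚ}
    (h : negOn S d (derPolyW S X J) a b = true) (hab : a ≤ b) (ha : 0 ≤ a) (hb : b ≤ 1)
    {x : ℝ} (hx : x ∈ Icc (1 - (b : ℝ)) (1 - a)) : 0 < frobSol₁ 1 χ x := by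
  obtain ⟨ht0, ht1, hta, htb⟩ := tcell_of_xcell ha hb hx
  obtain ⟨as, hmem, hev⟩ := exists_pmem_derPolyW hS hχ hM hcond ht0 ht1
  have hneg := negOn_sound hS h hab hmem hta htb
  rw [hev, show (1 : ℝ) - (1 - x) = x by ring] at hneg
  linarith

/-! ### Zero counting for `u_χ` on `(0, 1)`: kernel checks and their soundness -/

/-- The zero set of `u_χ` in `(0, 1)` (so that `frobZeros 1 χ` is its cardinality). [cite: CoddingtonLevinson1955, Ch. 8 §1] -/
def zset (χ : ℝ) : Set ℝ := {x | x ∈ Ioo (0 : ℝ) 1 ∧ frobSol 1 χ x = 0}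

/-- [cite: CoddingtonLevinson1955, Ch. 8 §1] -/
theorem zset_finite (χ : ℝ) : (zset χ).Finite := finite_zeros_frobSol one_pos χ

/-- [cite: CoddingtonLevinson1955, Ch. 8 §1] -/
theorem frobZeros_eq_ncard (χ : ℝ) : frobZeros 1 χ = (zset χ).ncard := rfl

/-- Certified sign of `u_χ(x)` at a rational point `x ∈ [0,1]` (`1`, `−1`, or `0` = unknown): one
interval Horner evaluation of the widened value polynomial at `t = 1 − x`. [cite: Moore1979, Sect. 2.2 (2.16)–(2.21)] -/
def sgnAt (S : ℕ) (X : MI) (J : ℕ) (x : ℚ) : ℤ :=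
  let E := hornerI S (valPolyW S X J) (ofRat S (1 - x))
  if 0 < E.lo then 1 else if E.hi < 0 then -1 else 0

/-- `sgnAt = 1 ⇒ u_χ(x) > 0`. [cite: Moore1979, Sect. 2.2 (2.16)–(2.21)] -/
theorem frobSol_pos_of_sgnAt {S : ℕ} (hS : 0 < S) {χ M : ℝ} {X : MI} (hχ : MI.mem S χ X) {J : ℕ}
    (hM : |4 * π ^ 2 - χ| ≤ M) (hcond : Cond M (3 / 4) J) {x : ℚ} (h : sgnAt S X J x = 1)
    (hx0 : 0 ≤ x) (hx1 : x ≤ 1) : 0 < frobSol 1 χ x := by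
  have hx0' : (0 : ℝ) ≤ x := by exact_mod_cast hx0
  have hx1' : (x : ℝ) ≤ 1 := by exact_mod_cast hx1
  have ht0 : (0 : ℝ) ≤ ((1 - x : ℚ) : ℝ) := by push_cast; linarith
  have ht1 : ((1 - x : ℚ) : ℝ) ≤ 1 := by push_cast; linarith
  obtain ⟨as, hmem, hev⟩ := exists_pmem_valPolyW hS hχ hM hcond ht0 ht1
  have hE := mem_hornerI hS (mem_ofRat S (1 - x)) hmem
  rw [hev, show (1 : ℝ) - ((1 - x : ℚ) : ℝ) = x by push_cast; ring] at hE
  by_cases h1 : 0 < (hornerI S (valPolyW S X J) (ofRat S (1 - x))).lo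
  · exact MI.pos_of_lo_pos hE h1
  · exfalso
    by_cases h2 : (hornerI S (valPolyW S X J) (ofRat S (1 - x))).hi < 0
    · simp only [sgnAt, if_neg h1, if_pos h2] at h; norm_num at h
    · simp only [sgnAt, if_neg h1, if_neg h2] at h; norm_num at h

/-- `sgnAt = −1 ⇒ u_χ(x) < 0`. [cite: Moore1979, Sect. 2.2 (2.16)–(2.21)] -/
theorem frobSol_neg_of_sgnAt {S : ℕ} (hS : 0 < S) {χ M : ℝ} {X : MI} (hχ : MI.mem S χ X) {J : ℕ}
    (hM : |4 * π ^ 2 - χ| ≤ M) (hcond : Cond M (3 / 4) J) {x : ℚ} (h : sgnAt S X J x = -1)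
    (hx0 : 0 ≤ x) (hx1 : x ≤ 1) : frobSol 1 χ x < 0 := by
  have hx0' : (0 : ℝ) ≤ x := by exact_mod_cast hx0
  have hx1' : (x : ℝ) ≤ 1 := by exact_mod_cast hx1
  have ht0 : (0 : ℝ) ≤ ((1 - x : ℚ) : ℝ) := by push_cast; linarith
  have ht1 : ((1 - x : ℚ) : ℝ) ≤ 1 := by push_cast; linarith
  obtain ⟨as, hmem, hev⟩ := exists_pmem_valPolyW hS hχ hM hcond ht0 ht1
  have hE := mem_hornerI hS (mem_ofRat S (1 - x)) hmem
  rw [hev, show (1 : ℝ) - ((1 - x : ℚ) : ℝ) = x by push_cast; ring] at hE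
  by_cases h1 : 0 < (hornerI S (valPolyW S X J) (ofRat S (1 - x))).lo
  · exfalso; simp only [sgnAt, if_pos h1] at h; norm_num at h
  · by_cases h2 : (hornerI S (valPolyW S X J) (ofRat S (1 - x))).hi < 0
    · exact MI.neg_of_hi_neg hE h2
    · exfalso; simp only [sgnAt, if_neg h1, if_neg h2] at h; norm_num at h

/-- Kernel check of `k` sign alternations of `u_χ` at increasing rational points of `[0, 1)`
(`k + 1` points). [cite: Kearfott1987, Sect. 1; AlefeldMayer2000, Sect. 4] -/
def altOK (S : ℕ) (X : MI) (J : ℕ) : List ℚ → Bool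
  | [] => true
  | [x] => decide (0 ≤ x) && decide (x < 1) && (sgnAt S X J x != 0)
  | x :: y :: rest => decide (0 ≤ x) && decide (x < 1) && decide (x < y) &&
      (sgnAt S X J x * sgnAt S X J y == -1) && altOK S X J (y :: rest)

/-- Head conditions of `altOK`. [folklore] -/
private theorem altOK_head {S : ℕ} {X : MI} {J : ℕ} {y : ℚ} {l : List ℚ} (h : altOK S X J (y :: l) = true) :
    0 ≤ y ∧ y < 1 := by
  cases l with
  | nil =>
      simp only [altOK, Bool.and_eq_true, decide_eq_true_eq] at h
      exact ⟨h.1.1, h.1.2⟩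
  | cons z rest =>
      simp only [altOK, Bool.and_eq_true, decide_eq_true_eq] at h
      exact ⟨h.1.1.1.1, h.1.1.1.2⟩

/-- A sign value of `sgnAt` is `1`, `−1` or `0`. [folklore] -/
private theorem sgnAt_cases (S : ℕ) (X : MI) (J : ℕ) (x : ℚ) :
    sgnAt S X J x = 1 ∨ sgnAt S X J x = -1 ∨ sgnAt S X J x = 0 := by
  unfold sgnAt; dsimp only; split_ifs <;> simp

/-- **Lower bound for the zero count.**  If `altOK (x :: rest)` passes then `u_χ` has at least
`|rest|` zeros in `(x, 1) ⊆ (0, 1)` (intermediate value theorem between consecutive points).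
[cite: Kearfott1987, Sect. 1; AlefeldMayer2000, Sect. 4] -/
theorem le_ncard_of_altOK {S : ℕ} (hS : 0 < S) {χ M : ℝ} {X : MI} (hχ : MI.mem S χ X) {J : ℕ}
    (hM : |4 * π ^ 2 - χ| ≤ M) (hcond : Cond M (3 / 4) J) :
    ∀ (rest : List ℚ) (x : ℚ), altOK S X J (x :: rest) = true →
      rest.length ≤ {z ∈ zset χ | ((x : ℚ) : ℝ) < z}.ncard
  | [], x, _ => by simp
  | y :: rest, x, h => by
      have hrec : altOK S X J (y :: rest) = true := by
        simp only [altOK, Bool.and_eq_true] at h; exact h.2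
      obtain ⟨hy0, hy1⟩ := altOK_head hrec
      have hx0 : 0 ≤ x := by simp only [altOK, Bool.and_eq_true, decide_eq_true_eq] at h; exact h.1.1.1.1
      have hxy : x < y := by simp only [altOK, Bool.and_eq_true, decide_eq_true_eq] at h; exact h.1.1.2
      have hprod : sgnAt S X J x * sgnAt S X J y = -1 := by
        simp only [altOK, Bool.and_eq_true, beq_iff_eq] at h; exact h.1.2
      have ih := le_ncard_of_altOK hS hχ hM hcond rest y hrec
      -- a zero strictly between x and y
      have hcont : ContinuousOn (frobSol 1 χ) (Icc (x : ℝ) y) :=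
        (continuousOn_frobSol_Icc one_pos χ).mono (Icc_subset_Icc (by exact_mod_cast hx0) (by exact_mod_cast hy1.le))
      have hxyR : ((x : ℚ) : ℝ) ≤ y := by exact_mod_cast hxy.le
      have hz : ∃ z ∈ Ioo ((x : ℚ) : ℝ) y, frobSol 1 χ z = 0 := by
        rcases sgnAt_cases S X J x with h1 | h1 | h1 <;>
          rcases sgnAt_cases S X J y with h2 | h2 | h2 <;>
          simp only [h1, h2] at hprod <;> norm_num at hprod
        · -- x: +, y: -
          have hpx := frobSol_pos_of_sgnAt hS hχ hM hcond h1 hx0 (by linarith)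
          have hny := frobSol_neg_of_sgnAt hS hχ hM hcond h2 hy0 hy1.le
          obtain ⟨z, hz, hz0⟩ := intermediate_value_Ioo' hxyR hcont ⟨hny, hpx⟩
          exact ⟨z, hz, hz0⟩
        · -- x: -, y: +
          have hnx := frobSol_neg_of_sgnAt hS hχ hM hcond h1 hx0 (by linarith)
          have hpy := frobSol_pos_of_sgnAt hS hχ hM hcond h2 hy0 hy1.le
          obtain ⟨z, hz, hz0⟩ := intermediate_value_Ioo hxyR hcont ⟨hnx, hpy⟩
          exact ⟨z, hz, hz0⟩
      obtain ⟨z, hz, hz0⟩ := hz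
      have hzset : z ∈ {w ∈ zset χ | ((x : ℚ) : ℝ) < w} := by
        refine ⟨⟨⟨?_, ?_⟩, hz0⟩, hz.1⟩
        · have : (0 : ℝ) ≤ x := by exact_mod_cast hx0
          linarith [hz.1]
        · have : ((y : ℚ) : ℝ) < 1 := by exact_mod_cast hy1
          linarith [hz.2]
      have hsub : insert z {w ∈ zset χ | ((y : ℚ) : ℝ) < w} ⊆ {w ∈ zset χ | ((x : ℚ) : ℝ) < w} := by
        intro w hw
        rcases hw with rfl | hw
        · exact hzset
        · exact ⟨hw.1, lt_trans (by exact_mod_cast hxy) hw.2⟩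
      have hfin : {w ∈ zset χ | ((x : ℚ) : ℝ) < w}.Finite := (zset_finite χ).subset (sep_subset _ _)
      have hnot : z ∉ {w ∈ zset χ | ((y : ℚ) : ℝ) < w} := fun hw ↦ by linarith [hw.2, hz.2]
      have hfin' : {w ∈ zset χ | ((y : ℚ) : ℝ) < w}.Finite := (zset_finite χ).subset (sep_subset _ _)
      calc (y :: rest).length = rest.length + 1 := by simp
        _ ≤ {w ∈ zset χ | ((y : ℚ) : ℝ) < w}.ncard + 1 := by omega
        _ = (insert z {w ∈ zset χ | ((y : ℚ) : ℝ) < w}).ncard := (Set.ncard_insert_of_notMem hnot hfin').symm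
        _ ≤ _ := Set.ncard_le_ncard hsub hfin

/-- **From `altOK` to the zero count:** `|rest| ≤ N(χ)`. [cite: Kearfott1987, Sect. 1; AlefeldMayer2000, Sect. 4] -/
theorem le_frobZeros_of_altOK {S : ℕ} (hS : 0 < S) {χ M : ℝ} {X : MI} (hχ : MI.mem S χ X) {J : ℕ}
    (hM : |4 * π ^ 2 - χ| ≤ M) (hcond : Cond M (3 / 4) J) {x : ℚ} {rest : List ℚ}
    (h : altOK S X J (x :: rest) = true) : rest.length ≤ frobZeros 1 χ := by
  rw [frobZeros_eq_ncard]
  exact (le_ncard_of_altOK hS hχ hM hcond rest x h).trans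
    (Set.ncard_le_ncard (sep_subset _ _) (zset_finite χ))

/-- Kernel check of one cell `[s, τ]` (in `t = 1 − x`) with a sign hint: a sign of `u′_χ` (monotone
cell; `pos` = `u′ > 0`, i.e. the enclosure of `−u′` is negative) or of `u_χ` (zero-free cell). [cite: Kearfott1987, Sect. 1; AlefeldMayer2000, Sect. 4] -/
def cellOK (S : ℕ) (X : MI) (J d : ℕ) (s τ : ℚ) (mono pos : Bool) : Bool :=
  if mono then (if pos then negOn S d (derPolyW S X J) s τ else posOn S d (derPolyW S X J) s τ)
  else (if pos then posOn S d (valPolyW S X J) s τ else negOn S d (valPolyW S X J) s τ)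

/-- Kernel check of a partition of `[s, 1]` into checked cells `(τ, mono, pos)`. [cite: Kearfott1987, Sect. 1; AlefeldMayer2000, Sect. 4] -/
def cellsOK (S : ℕ) (X : MI) (J d : ℕ) : ℚ → List (ℚ × Bool × Bool) → Bool
  | s, [] => decide (s = 1)
  | s, (τ, m, p) :: rest => decide (s ≤ τ) && decide (τ ≤ 1) && cellOK S X J d s τ m p && cellsOK S X J d τ rest

/-- The number of monotone cells. [cite: Kearfott1987, Sect. 1; AlefeldMayer2000, Sect. 4] -/
def monoCount : List (ℚ × Bool × Bool) → ℕ
  | [] => 0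
  | (_, m, _) :: rest => (if m then 1 else 0) + monoCount rest

/-- On a monotone cell the zeros of `u_χ` form a subsingleton. [cite: Kearfott1987, Sect. 1; AlefeldMayer2000, Sect. 4] -/
theorem zeros_subsingleton_of_mono {S : ℕ} (hS : 0 < S) {χ M : ℝ} {X : MI} (hχ : MI.mem S χ X)
    {J d : ℕ} (hM : |4 * π ^ 2 - χ| ≤ M) (hcond : Cond M (3 / 4) J) {s τ : ℚ} {p : Bool}
    (h : cellOK S X J d s τ true p = true) (hsτ : s ≤ τ) (hs : 0 ≤ s) (hτ : τ ≤ 1) :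
    {w ∈ zset χ | w ∈ Icc (1 - (τ : ℝ)) (1 - s)}.Subsingleton := by
  have hcont : ContinuousOn (frobSol 1 χ) (Icc (1 - (τ : ℝ)) (1 - s)) := by
    refine (continuousOn_frobSol_Icc one_pos χ).mono (Icc_subset_Icc ?_ ?_)
    · have : ((τ : ℚ) : ℝ) ≤ 1 := by exact_mod_cast hτ
      linarith
    · have : (0 : ℝ) ≤ s := by exact_mod_cast hs
      linarith
  have hderiv : ∀ w ∈ interior (Icc (1 - (τ : ℝ)) (1 - s)), deriv (frobSol 1 χ) w = frobSol₁ 1 χ w := by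
    intro w hw
    rw [interior_Icc] at hw
    have : ((τ : ℚ) : ℝ) ≤ 1 := by exact_mod_cast hτ
    have : (0 : ℝ) ≤ s := by exact_mod_cast hs
    exact (hasDerivAt_frobSol one_pos χ (by rw [abs_lt]; constructor <;> linarith [hw.1, hw.2])).deriv
  have hinj : InjOn (frobSol 1 χ) (Icc (1 - (τ : ℝ)) (1 - s)) := by
    cases p with
    | false =>
      simp only [cellOK, if_true, Bool.false_eq_true, if_false] at h
      refine (strictAntiOn_of_deriv_neg (convex_Icc _ _) hcont fun w hw ↦ ?_).injOn
      rw [hderiv w hw]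
      rw [interior_Icc] at hw
      exact frobSol₁_neg_of_posOn hS hχ hM hcond h hsτ hs hτ (Ioo_subset_Icc_self hw)
    | true =>
      simp only [cellOK, if_true] at h
      refine (strictMonoOn_of_deriv_pos (convex_Icc _ _) hcont fun w hw ↦ ?_).injOn
      rw [hderiv w hw]
      rw [interior_Icc] at hw
      exact frobSol₁_pos_of_negOn hS hχ hM hcond h hsτ hs hτ (Ioo_subset_Icc_self hw)
  intro a ha b hb
  exact hinj ha.2 hb.2 (by rw [ha.1.2, hb.1.2])

/-- On a zero-free cell there are no zeros. [cite: Kearfott1987, Sect. 1; AlefeldMayer2000, Sect. 4] -/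
theorem zeros_empty_of_def {S : ℕ} (hS : 0 < S) {χ M : ℝ} {X : MI} (hχ : MI.mem S χ X)
    {J d : ℕ} (hM : |4 * π ^ 2 - χ| ≤ M) (hcond : Cond M (3 / 4) J) {s τ : ℚ} {p : Bool}
    (h : cellOK S X J d s τ false p = true) (hsτ : s ≤ τ) (hs : 0 ≤ s) (hτ : τ ≤ 1) :
    {w ∈ zset χ | w ∈ Icc (1 - (τ : ℝ)) (1 - s)} = ∅ := by
  ext w
  simp only [mem_sep_iff, mem_empty_iff_false, iff_false, not_and]
  intro hw hwI
  cases p with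
  | true =>
    simp only [cellOK, Bool.false_eq_true, if_false, if_true] at h
    exact absurd hw.2 (frobSol_pos_of_posOn hS hχ hM hcond h hsτ hs hτ hwI).ne'
  | false =>
    simp only [cellOK, Bool.false_eq_true, if_false] at h
    exact absurd hw.2 (frobSol_neg_of_negOn hS hχ hM hcond h hsτ hs hτ hwI).ne

/-- **Upper bound for the zero count.**  If the cells from `s` to `1` pass, the number of zeros of
`u_χ` with `x ≤ 1 − s` is at most the number of monotone cells. [cite: Kearfott1987, Sect. 1; AlefeldMayer2000, Sect. 4] -/
theorem ncard_le_of_cellsOK {S : ℕ} (hS : 0 < S) {χ M : ℝ} {X : MI} (hχ : MI.mem S χ X) {J d : ℕ}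
    (hM : |4 * π ^ 2 - χ| ≤ M) (hcond : Cond M (3 / 4) J) :
    ∀ (cells : List (ℚ × Bool × Bool)) (s : ℚ), cellsOK S X J d s cells = true → 0 ≤ s →
      {w ∈ zset χ | w ≤ 1 - (s : ℝ)}.ncard ≤ monoCount cells
  | [], s, h, _ => by
      simp only [cellsOK, decide_eq_true_eq] at h
      subst h
      have : {w ∈ zset χ | w ≤ 1 - ((1 : ℚ) : ℝ)} = ∅ := by
        ext w
        simp only [mem_sep_iff, mem_empty_iff_false, iff_false, not_and, Rat.cast_one, sub_self]
        intro hw hle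
        exact absurd hw.1.1 (not_lt.mpr hle)
      rw [this, Set.ncard_empty, monoCount]
  | (τ, m, p) :: rest, s, h, hs => by
      simp only [cellsOK, Bool.and_eq_true, decide_eq_true_eq] at h
      obtain ⟨⟨⟨hsτ, hτ1⟩, hcell⟩, hrest⟩ := h
      have ih := ncard_le_of_cellsOK hS hχ hM hcond rest τ hrest (hs.trans hsτ)
      set A := {w ∈ zset χ | w ∈ Icc (1 - (τ : ℝ)) (1 - s)} with hA
      set B := {w ∈ zset χ | w ≤ 1 - (τ : ℝ)} with hB
      have hsub : {w ∈ zset χ | w ≤ 1 - (s : ℝ)} ⊆ A ∪ B := by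
        intro w hw
        by_cases hwτ : w ≤ 1 - (τ : ℝ)
        · exact Or.inr ⟨hw.1, hwτ⟩
        · exact Or.inl ⟨hw.1, ⟨(not_le.mp hwτ).le, hw.2⟩⟩
      have hfinAB : (A ∪ B).Finite :=
        ((zset_finite χ).subset (sep_subset _ _)).union ((zset_finite χ).subset (sep_subset _ _))
      have hAfin : A.Finite := (zset_finite χ).subset (sep_subset _ _)
      have hAle : A.ncard ≤ (if m then 1 else 0) := by
        cases m with
        | true =>
            simp only [if_true]
            exact (Set.ncard_le_one hAfin).mpr (zeros_subsingleton_of_mono hS hχ hM hcond hcell hsτ hs hτ1)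
        | false =>
            simp only [Bool.false_eq_true, if_false]
            rw [hA, zeros_empty_of_def hS hχ hM hcond hcell hsτ hs hτ1, Set.ncard_empty]
      calc {w ∈ zset χ | w ≤ 1 - (s : ℝ)}.ncard ≤ (A ∪ B).ncard := Set.ncard_le_ncard hsub hfinAB
        _ ≤ A.ncard + B.ncard := Set.ncard_union_le A B
        _ ≤ (if m then 1 else 0) + monoCount rest := Nat.add_le_add hAle ih
        _ = monoCount ((τ, m, p) :: rest) := by rw [monoCount]

/-- **From `cellsOK` to the zero count:** `N(χ) ≤ #monotone cells`. [cite: Kearfott1987, Sect. 1; AlefeldMayer2000, Sect. 4] -/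
theorem frobZeros_le_of_cellsOK {S : ℕ} (hS : 0 < S) {χ M : ℝ} {X : MI} (hχ : MI.mem S χ X) {J d : ℕ}
    (hM : |4 * π ^ 2 - χ| ≤ M) (hcond : Cond M (3 / 4) J) {cells : List (ℚ × Bool × Bool)}
    (h : cellsOK S X J d 0 cells = true) : frobZeros 1 χ ≤ monoCount cells := by
  have h1 := ncard_le_of_cellsOK hS hχ hM hcond cells 0 h le_rfl
  rw [frobZeros_eq_ncard]
  refine le_trans (le_of_eq ?_) h1
  congr 1
  ext w
  simp only [mem_sep_iff, Rat.cast_zero, sub_zero, iff_self_and]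
  exact fun hw ↦ hw.1.2.le

/-! ### Kernel side: the sign of `B(χ) = u′_χ(0)`, the integrals `u_χ(0)`, `∫u_χ`, `∫u_χ²` -/

/-- Certified sign of `B(χ) = u′_χ(0)` (one Horner evaluation of the widened derivative polynomial
at `t = 1`; recall `derPolyW` encloses `−u′`). [cite: Moore1979, Sect. 2.2 (2.16)–(2.21)] -/
def bsgn (S : ℕ) (X : MI) (J : ℕ) : ℤ :=
  let E := hornerI S (derPolyW S X J) (MI.ofInt S 1)
  if 0 < E.lo then -1 else if E.hi < 0 then 1 else 0

/-- `bsgn = 1 ⇒ u′_χ(0) > 0`. [cite: Moore1979, Sect. 2.2 (2.16)–(2.21)] -/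
theorem frobSol₁_zero_pos_of_bsgn {S : ℕ} (hS : 0 < S) {χ M : ℝ} {X : MI} (hχ : MI.mem S χ X)
    {J : ℕ} (hM : |4 * π ^ 2 - χ| ≤ M) (hcond : Cond M (3 / 4) J) (h : bsgn S X J = 1) :
    0 < frobSol₁ 1 χ 0 := by
  obtain ⟨as, hmem, hev⟩ := exists_pmem_derPolyW hS hχ hM hcond (t := 1) zero_le_one le_rfl
  have hE := mem_hornerI hS (by simpa using MI.mem_ofInt S 1 : MI.mem S (1:ℝ) (MI.ofInt S 1)) hmem
  rw [hev, sub_self] at hE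
  by_cases h1 : 0 < (hornerI S (derPolyW S X J) (MI.ofInt S 1)).lo
  · exfalso; simp only [bsgn, if_pos h1] at h; norm_num at h
  · by_cases h2 : (hornerI S (derPolyW S X J) (MI.ofInt S 1)).hi < 0
    · have := MI.neg_of_hi_neg hE h2; linarith
    · exfalso; simp only [bsgn, if_neg h1, if_neg h2] at h; norm_num at h

/-- `bsgn = −1 ⇒ u′_χ(0) < 0`. [cite: Moore1979, Sect. 2.2 (2.16)–(2.21)] -/
theorem frobSol₁_zero_neg_of_bsgn {S : ℕ} (hS : 0 < S) {χ M : ℝ} {X : MI} (hχ : MI.mem S χ X)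
    {J : ℕ} (hM : |4 * π ^ 2 - χ| ≤ M) (hcond : Cond M (3 / 4) J) (h : bsgn S X J = -1) :
    frobSol₁ 1 χ 0 < 0 := by
  obtain ⟨as, hmem, hev⟩ := exists_pmem_derPolyW hS hχ hM hcond (t := 1) zero_le_one le_rfl
  have hE := mem_hornerI hS (by simpa using MI.mem_ofInt S 1 : MI.mem S (1:ℝ) (MI.ofInt S 1)) hmem
  rw [hev, sub_self] at hE
  by_cases h1 : 0 < (hornerI S (derPolyW S X J) (MI.ofInt S 1)).lo
  · have := MI.pos_of_lo_pos hE h1; linarith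
  · exfalso
    by_cases h2 : (hornerI S (derPolyW S X J) (MI.ofInt S 1)).hi < 0
    · simp only [bsgn, if_neg h1, if_pos h2] at h; norm_num at h
    · simp only [bsgn, if_neg h1, if_neg h2] at h; norm_num at h

/-- Enclosure of `u_χ(0)` (`t = 1`). [cite: Moore1979, Sect. 2.2 (2.16)–(2.21)] -/
def u0I (S : ℕ) (X : MI) (J : ℕ) : MI := hornerI S (valPolyW S X J) (MI.ofInt S 1)

/-- `u_χ(0) ∈ u0I`. [cite: CoddingtonLevinson1955, Ch. 4 §8] -/
theorem mem_u0I {S : ℕ} (hS : 0 < S) {χ M : ℝ} {X : MI} (hχ : MI.mem S χ X) {J : ℕ}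
    (hM : |4 * π ^ 2 - χ| ≤ M) (hcond : Cond M (3 / 4) J) : MI.mem S (frobSol 1 χ 0) (u0I S X J) := by
  obtain ⟨as, hmem, hev⟩ := exists_pmem_valPolyW hS hχ hM hcond (t := 1) zero_le_one le_rfl
  have h := mem_hornerI hS (by simpa using MI.mem_ofInt S 1 : MI.mem S (1:ℝ) (MI.ofInt S 1)) hmem
  rw [hev, sub_self] at h
  exact h

/-- Enclosure of `∫₀¹ u_χ`: the moments of the value polynomial widened by the tail radius. [cite: Moore1979, Sect. 2.2 (2.16)–(2.21)] -/
def i1I (S : ℕ) (X : MI) (J : ℕ) : MI := (momI 0 (coeffsI S X (J + 3))).widen (rhoS S X J)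

/-- `u_χ` is continuous on `[0, 1]` as a function of `t = 1 − x` as well. [folklore] -/
private theorem continuousOn_frobSol_comp (χ : ℝ) :
    ContinuousOn (fun t : ℝ ↦ frobSol 1 χ (1 - t)) (Icc 0 1) := by
  refine (continuousOn_frobSol_Icc one_pos χ).comp (continuous_const.sub continuous_id).continuousOn ?_
  intro t ht; exact ⟨by linarith [ht.2], by linarith [ht.1]⟩

/-- `∫₀¹ u_χ(x) dx = ∫₀¹ u_χ(1 − t) dt`. [folklore] -/
private theorem integral_frobSol_comp (χ : ℝ) :
    ∫ x in (0:ℝ)..1, frobSol 1 χ x = ∫ t in (0:ℝ)..1, frobSol 1 χ (1 - t) := by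
  have h := intervalIntegral.integral_comp_sub_left (fun x ↦ frobSol 1 χ x) (1 : ℝ) (a := 0) (b := 1)
  simp only [sub_self, sub_zero] at h
  rw [h]

/-- `∫₀¹ u_χ ∈ i1I`. [cite: CoddingtonLevinson1955, Ch. 4 §8] -/
theorem mem_i1I {S : ℕ} (hS : 0 < S) {χ M : ℝ} {X : MI} (hχ : MI.mem S χ X) {J : ℕ}
    (hM : |4 * π ^ 2 - χ| ≤ M) (hcond : Cond M (3 / 4) J) :
    MI.mem S (∫ x in (0:ℝ)..1, frobSol 1 χ x) (i1I S X J) := by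
  have hP := mem_momI 0 (pmem_coeffsI hS hχ (J + 3))
  rw [← integral_evalR] at hP
  unfold i1I
  refine MI.mem_widen hP ?_
  rw [integral_frobSol_comp]
  -- the remainder integral
  have hiu : IntervalIntegrable (fun t : ℝ ↦ frobSol 1 χ (1 - t)) volume 0 1 :=
    (continuousOn_frobSol_comp χ).intervalIntegrable_of_Icc zero_le_one
  have hiP : IntervalIntegrable (fun t : ℝ ↦ evalR (coeffList χ (J + 3)) t) volume 0 1 :=
    (continuous_evalR _).intervalIntegrable _ _
  rw [← intervalIntegral.integral_sub hiu hiP]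
  have hSr : (0 : ℝ) < S := by exact_mod_cast hS
  have hbound : ∀ t ∈ Ι (0:ℝ) 1, ‖frobSol 1 χ (1 - t) - evalR (coeffList χ (J + 3)) t‖ ≤ (rhoS S X J : ℝ) / S := by
    intro t ht
    rw [uIoc_of_le zero_le_one] at ht
    rw [Real.norm_eq_abs, le_div_iff₀ hSr]
    exact value_remainder_le hS hχ hM hcond ht.1.le ht.2
  have h := intervalIntegral.norm_integral_le_of_norm_le_const hbound
  rw [Real.norm_eq_abs] at h
  calc |(∫ t in (0:ℝ)..1, frobSol 1 χ (1 - t) - evalR (coeffList χ (J + 3)) t)| * S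
      ≤ (rhoS S X J : ℝ) / S * |1 - 0| * S := by gcongr
    _ = (rhoS S X J : ℝ) := by field_simp; simp

/-- Scaled error bound for `∫ (2 P R + R²)`: `⌈(2·|P|_∞·ρ + ρ²)⌉` in units of `1/S`. [cite: Moore1979, Sect. 2.2 (2.16)–(2.21)] -/
def i2err (S : ℕ) (X : MI) (J : ℕ) : ℤ :=
  Numerics.cdiv (2 * absBoundI S 1 1 (coeffsI S X (J + 3)) * rhoS S X J + rhoS S X J * rhoS S X J) S

/-- Enclosure of `∫₀¹ u_χ²`. [cite: Moore1979, Sect. 2.2 (2.16)–(2.21)] -/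
def i2I (S : ℕ) (X : MI) (J : ℕ) : MI :=
  (momI 0 (mulI S (coeffsI S X (J + 3)) (coeffsI S X (J + 3)))).widen (i2err S X J)

/-- `∫₀¹ u_χ² ∈ i2I`. [cite: CoddingtonLevinson1955, Ch. 4 §8] -/
theorem mem_i2I {S : ℕ} (hS : 0 < S) {χ M : ℝ} {X : MI} (hχ : MI.mem S χ X) {J : ℕ}
    (hM : |4 * π ^ 2 - χ| ≤ M) (hcond : Cond M (3 / 4) J) :
    MI.mem S (∫ x in (0:ℝ)..1, frobSol 1 χ x ^ 2) (i2I S X J) := by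
  set as := coeffList χ (J + 3) with has
  have hPP := mem_momI 0 (pmem_mulI hS (pmem_coeffsI hS hχ (J + 3)) (pmem_coeffsI hS hχ (J + 3)))
  rw [← integral_evalR] at hPP
  simp only [evalR_mulR] at hPP
  unfold i2I
  refine MI.mem_widen hPP ?_
  -- ∫ u(x)^2 dx = ∫ u(1-t)^2 dt
  have hcomp : ∫ x in (0:ℝ)..1, frobSol 1 χ x ^ 2 = ∫ t in (0:ℝ)..1, frobSol 1 χ (1 - t) ^ 2 := by
    have h := intervalIntegral.integral_comp_sub_left (fun x ↦ frobSol 1 χ x ^ 2) (1 : ℝ) (a := 0) (b := 1)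
    simp only [sub_self, sub_zero] at h
    rw [h]
  rw [hcomp]
  have hSr : (0 : ℝ) < S := by exact_mod_cast hS
  set ρ : ℝ := (rhoS S X J : ℝ) / S with hρ
  set PA : ℝ := (absBoundI S 1 1 (coeffsI S X (J + 3)) : ℝ) / S with hPA
  have hPabs : ∀ t ∈ Icc (0:ℝ) 1, |evalR as t| ≤ PA := by
    intro t ht
    rw [hPA, le_div_iff₀ hSr]
    exact abs_evalR_le_absBoundI hS (pmem_coeffsI hS hχ (J + 3)) (by rw [abs_of_nonneg ht.1]; exact ht.2)
  have hR : ∀ t ∈ Icc (0:ℝ) 1, |frobSol 1 χ (1 - t) - evalR as t| ≤ ρ := by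
    intro t ht
    rw [hρ, le_div_iff₀ hSr]
    exact value_remainder_le hS hχ hM hcond ht.1 ht.2
  have hρ0 : 0 ≤ ρ := (abs_nonneg _).trans (hR 0 ⟨le_rfl, zero_le_one⟩)
  have hPA0 : 0 ≤ PA := (abs_nonneg _).trans (hPabs 0 ⟨le_rfl, zero_le_one⟩)
  have hiu2 : IntervalIntegrable (fun t : ℝ ↦ frobSol 1 χ (1 - t) ^ 2) volume 0 1 :=
    ((continuousOn_frobSol_comp χ).pow 2).intervalIntegrable_of_Icc zero_le_one
  have hiP2 : IntervalIntegrable (fun t : ℝ ↦ evalR as t * evalR as t) volume 0 1 :=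
    ((continuous_evalR _).mul (continuous_evalR _)).intervalIntegrable _ _
  rw [← intervalIntegral.integral_sub hiu2 hiP2]
  have hbound : ∀ t ∈ Ι (0:ℝ) 1,
      ‖frobSol 1 χ (1 - t) ^ 2 - evalR as t * evalR as t‖ ≤ 2 * PA * ρ + ρ ^ 2 := by
    intro t ht
    rw [uIoc_of_le zero_le_one] at ht
    have ht' : t ∈ Icc (0:ℝ) 1 := ⟨ht.1.le, ht.2⟩
    set R := frobSol 1 χ (1 - t) - evalR as t with hRdef
    have e : frobSol 1 χ (1 - t) ^ 2 - evalR as t * evalR as t = 2 * evalR as t * R + R ^ 2 := by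
      rw [hRdef]; ring
    rw [e, Real.norm_eq_abs]
    have h1 : |evalR as t| ≤ PA := hPabs t ht'
    have h2 : |R| ≤ ρ := hR t ht'
    calc |2 * evalR as t * R + R ^ 2| ≤ |2 * evalR as t * R| + |R ^ 2| := abs_add_le _ _
      _ = 2 * (|evalR as t| * |R|) + |R| ^ 2 := by rw [abs_mul, abs_mul, abs_pow, abs_two]; ring
      _ ≤ 2 * (PA * ρ) + ρ ^ 2 := by gcongr
      _ = 2 * PA * ρ + ρ ^ 2 := by ring
  have h := intervalIntegral.norm_integral_le_of_norm_le_const hbound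
  rw [Real.norm_eq_abs, sub_zero, abs_one, mul_one] at h
  -- compare with the integer `i2err`
  have hc := Numerics.le_cdiv_mul_real
    (a := 2 * absBoundI S 1 1 (coeffsI S X (J + 3)) * rhoS S X J + rhoS S X J * rhoS S X J)
    (b := S) (by exact_mod_cast hS)
  unfold i2err
  push_cast at hc
  have e2 : (2 * PA * ρ + ρ ^ 2) * S
      = (2 * (absBoundI S 1 1 (coeffsI S X (J + 3)) : ℝ) * (rhoS S X J : ℝ)
          + (rhoS S X J : ℝ) * (rhoS S X J : ℝ)) / S := by
    rw [hPA, hρ]; field_simp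
  calc |(∫ t in (0:ℝ)..1, frobSol 1 χ (1 - t) ^ 2 - evalR as t * evalR as t)| * S
      ≤ (2 * PA * ρ + ρ ^ 2) * S := by gcongr
    _ ≤ _ := by rw [e2, div_le_iff₀ hSr]; exact hc

/-! ### Kernel side: comparing enclosures with claimed rational bounds -/

/-- `q ≤ x` for every `x ∈ I`, certified on integers. [cite: Moore1979, Sect. 2.2 (2.16)–(2.21)] -/
def qLeI (S : ℕ) (q : ℚ) (I : MI) : Bool := decide ((ofRat S q).hi ≤ I.lo)

/-- `x ≤ q` for every `x ∈ I`, certified on integers. [cite: Moore1979, Sect. 2.2 (2.16)–(2.21)] -/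
def iLeQ (S : ℕ) (I : MI) (q : ℚ) : Bool := decide (I.hi ≤ (ofRat S q).lo)

/-- Soundness of `qLeI`. [cite: Moore1979, Sect. 2.2 (2.16)–(2.21)] -/
theorem le_of_qLeI {S : ℕ} {q : ℚ} {I : MI} (h : qLeI S q I = true) {x : ℝ} (hx : MI.mem S x I)
    (hS : 0 < S) : (q : ℝ) ≤ x := by
  have hq := (mem_ofRat S q).2
  have h' : ((ofRat S q).hi : ℝ) ≤ (I.lo : ℝ) := by
    simp only [qLeI, decide_eq_true_eq] at h; exact_mod_cast h
  have hSr : (0 : ℝ) < S := by exact_mod_cast hS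
  nlinarith [hx.1]

/-- Soundness of `iLeQ`. [cite: Moore1979, Sect. 2.2 (2.16)–(2.21)] -/
theorem le_of_iLeQ {S : ℕ} {q : ℚ} {I : MI} (h : iLeQ S I q = true) {x : ℝ} (hx : MI.mem S x I)
    (hS : 0 < S) : x ≤ (q : ℝ) := by
  have hq := (mem_ofRat S q).1
  have h' : (I.hi : ℝ) ≤ ((ofRat S q).lo : ℝ) := by
    simp only [iLeQ, decide_eq_true_eq] at h; exact_mod_cast h
  have hSr : (0 : ℝ) < S := by exact_mod_cast hS
  nlinarith [hx.2]

/-! ### The explicit prolate function built from `u_b` (even extension, normalised)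

This is the witness of `exists_isProlateFunction_of_frobSol` (`ProlateExistence.lean`) made explicit, so
that the VALUES `f(λ)`, `f(0)`, `∫ f` of the (unique) prolate function can be read off `u_b`. -/

/-- The sign `±1` making `s · u_b(0) > 0`. [cite: SlepianPollak1961, §III] -/
def frobSign (lam b : ℝ) : ℝ := if 0 < frobSol lam b 0 then 1 else -1

/-- `I_b = ∫₀^λ u_b²`. [cite: SlepianPollak1961, §III] -/
def frobI (lam b : ℝ) : ℝ := ∫ x in (0 : ℝ)..lam, frobSol lam b x ^ 2

/-- The normalisation constant `C_b = ±1/√(2 I_b)`. [cite: SlepianPollak1961, §III] -/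
def frobC (lam b : ℝ) : ℝ := frobSign lam b / Real.sqrt (2 * frobI lam b)

/-- The normalised even extension `x ↦ C_b u_b(|x|) 𝟙_{|x| ≤ λ}`.
[cite: SlepianPollak1961, §III; ConnesConsaniMoscovici2025, §7 (7.9)–(7.12)] -/
def frobWitness (lam b : ℝ) : ℝ → ℝ := fun x ↦ if |x| ≤ lam then frobC lam b * frobSol lam b |x| else 0

/-- **The explicit witness is a prolate function with `2k` zeros** when `u_b′(0) = 0` and `u_b` has `k`
zeros in `(0, λ)` — the proof of `exists_isProlateFunction_of_frobSol` (tree, `ProlateExistence.lean`)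
with the witness named. [cite: SlepianPollak1961, §III; ConnesConsaniMoscovici2025, §7 (7.9)–(7.12)] -/
theorem isProlateFunction_frobWitness {lam : ℝ} (hlam : 0 < lam) {b : ℝ} {k : ℕ}
    (hB : frobSol₁ lam b 0 = 0) (hN : {x | x ∈ Ioo 0 lam ∧ frobSol lam b x = 0}.ncard = k) :
    IsProlateFunction lam (2 * k) (frobWitness lam b) := by
  -- adapted from Literature/NumberTheory/LFunctions/ProlateExistence.lean (exists_isProlateFunction_of_frobSol)
  have h0mem : (0 : ℝ) ∈ Ioo (-lam) lam := ⟨by linarith, hlam⟩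
  have hA : frobSol lam b 0 ≠ 0 := fun h ↦ frobSol₁_ne_zero_of_zero hlam b h0mem h hB
  have heven := fun x (hx : x ∈ Ioo (-lam) lam) ↦ frobSol_neg_eq hlam hB hx
  have hcont := continuousOn_frobSol_Icc hlam b
  have hsol := isProlateODESol_frobSol hlam b
  set I := frobI lam b with hI'
  have hIdef : I = ∫ x in (0 : ℝ)..lam, frobSol lam b x ^ 2 := by rw [hI']; rfl
  have hIpos : 0 < I := by rw [hIdef]; exact integral_frobSol_sq_pos hlam b
  set s : ℝ := frobSign lam b with hs'
  have hs : s = if 0 < frobSol lam b 0 then 1 else -1 := by rw [hs']; rfl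
  have hs1 : s ^ 2 = 1 := by rw [hs]; split_ifs <;> norm_num
  have hsA : 0 < s * frobSol lam b 0 := by
    rw [hs]; split_ifs with h
    · simpa using h
    · have : frobSol lam b 0 < 0 := lt_of_le_of_ne (not_lt.mp h) hA
      linarith
  set C : ℝ := frobC lam b with hC'
  have hC : C = s / Real.sqrt (2 * I) := by rw [hC', hs', hI']; rfl
  have hsqrt : 0 < Real.sqrt (2 * I) := Real.sqrt_pos.mpr (by positivity)
  have hC2 : C ^ 2 * (2 * I) = 1 := by
    rw [hC, div_pow, hs1, Real.sq_sqrt (by positivity)]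
    field_simp
  have hC0 : C ≠ 0 := by
    intro h
    rw [h] at hC2
    simp at hC2
  set f : ℝ → ℝ := frobWitness lam b with hf'
  have hf : f = fun x ↦ if |x| ≤ lam then C * frobSol lam b |x| else 0 := by
    funext x; rw [hf', hC']; rfl
  have hfIoc : ∀ x ∈ Ioc (-lam) lam, f x = C * frobSol lam b x := by
    intro x hx
    have hxabs : |x| ≤ lam := abs_le.mpr ⟨hx.1.le, hx.2⟩
    simp only [hf, if_pos hxabs]
    rcases le_or_gt 0 x with h | h
    · rw [abs_of_nonneg h]
    · rw [abs_of_neg h, heven x ⟨hx.1, by linarith⟩]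
  have hfIco : ∀ x ∈ Ico (-lam) lam, f x = C * frobSol lam b (-x) := by
    intro x hx
    have hxabs : |x| ≤ lam := abs_le.mpr ⟨hx.1, hx.2.le⟩
    simp only [hf, if_pos hxabs]
    rcases le_or_gt 0 x with h | h
    · rw [abs_of_nonneg h, heven x ⟨by linarith, hx.2⟩]
    · rw [abs_of_neg h]
  have hfIoo : ∀ x ∈ Ioo (-lam) lam, f x = C * frobSol lam b x :=
    fun x hx ↦ hfIoc x ⟨hx.1, hx.2.le⟩
  have hfev : ∀ x ∈ Ioo (-lam) lam, f =ᶠ[𝓝 x] fun y ↦ C * frobSol lam b y := by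
    intro x hx
    filter_upwards [Ioo_mem_nhds hx.1 hx.2] with y hy using hfIoo y hy
  -- the zero set
  set Z := {x | x ∈ Ioo 0 lam ∧ frobSol lam b x = 0} with hZ
  have hZfin : Z.Finite := finite_zeros_frobSol hlam b
  have hZf : {x : ℝ | x ∈ Ioo (-lam) lam ∧ f x = 0} = Z ∪ (fun x ↦ -x) '' Z := by
    ext x
    simp only [mem_setOf_eq, mem_union, mem_image]
    constructor
    · rintro ⟨hx, hfx⟩
      rw [hfIoo x hx, mul_eq_zero] at hfx
      have hux := hfx.resolve_left hC0
      rcases lt_trichotomy x 0 with h | h | h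
      · refine Or.inr ⟨-x, ⟨⟨by linarith, by linarith [hx.1]⟩, ?_⟩, neg_neg x⟩
        rwa [heven x hx]
      · exact absurd (h ▸ hux) hA
      · exact Or.inl ⟨⟨h, hx.2⟩, hux⟩
    · rintro (⟨hx, hux⟩ | ⟨y, ⟨hy, huy⟩, rfl⟩)
      · have hx' : x ∈ Ioo (-lam) lam := ⟨by linarith [hx.1], hx.2⟩
        exact ⟨hx', by rw [hfIoo x hx', hux, mul_zero]⟩
      · have hy' : -y ∈ Ioo (-lam) lam := ⟨by linarith [hy.2], by linarith [hy.1]⟩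
        refine ⟨hy', ?_⟩
        rw [hfIoo (-y) hy', heven y ⟨by linarith [hy.1], hy.2⟩, huy, mul_zero]
  refine ⟨hlam, ?_, ?_, ?_, ?_, ?_, ?_, ?_⟩
  · -- C² on [−λ, λ]
    intro x hx
    by_cases hxl : x < lam
    · have hg : ContDiffAt ℝ 2 (fun y ↦ C * frobSol lam b (-y)) x := by
        have h1 : ContDiffAt ℝ 2 (frobSol lam b) (-x) :=
          (contDiffOn_frobSol hlam b).contDiffAt
            (Ioo_mem_nhds (by linarith [hx.2]) (by linarith [hx.1]))
        exact contDiffAt_const.mul (h1.comp x contDiffAt_id.neg)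
      refine hg.contDiffWithinAt.congr_of_eventuallyEq ?_ (hfIco x ⟨hx.1, hxl⟩)
      filter_upwards [nhdsWithin_le_nhds (Iio_mem_nhds hxl), self_mem_nhdsWithin] with y hy1 hy2
        using hfIco y ⟨hy2.1, hy1⟩
    · have hxl' : -lam < x := by linarith [not_lt.mp hxl]
      have hg : ContDiffAt ℝ 2 (fun y ↦ C * frobSol lam b y) x :=
        contDiffAt_const.mul ((contDiffOn_frobSol hlam b).contDiffAt
          (Ioo_mem_nhds hxl' (by linarith [hx.2])))
      refine hg.contDiffWithinAt.congr_of_eventuallyEq ?_ (hfIoc x ⟨hxl', hx.2⟩)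
      filter_upwards [nhdsWithin_le_nhds (Ioi_mem_nhds hxl'), self_mem_nhdsWithin] with y hy1 hy2
        using hfIoc y ⟨hy1, hy2.2⟩
  · -- the eigen-equation with `χ = b`
    refine ⟨b, fun x hx ↦ ?_⟩
    have hd1 : ∀ y ∈ Ioo (-lam) lam, deriv f y = C * frobSol₁ lam b y := by
      intro y hy
      rw [(hfev y hy).deriv_eq]
      exact ((hsol.hasDerivAt y (Ioo_subset_Ioo_three hlam hy)).const_mul C).deriv
    have hflux : deriv (fun y ↦ (lam ^ 2 - y ^ 2) * deriv f y) x =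
        C * (((2 * π * lam * x) ^ 2 - b) * frobSol lam b x) := by
      have hev : (fun y ↦ (lam ^ 2 - y ^ 2) * deriv f y) =ᶠ[𝓝 x]
          fun y ↦ C * ((lam ^ 2 - y ^ 2) * frobSol₁ lam b y) := by
        filter_upwards [Ioo_mem_nhds hx.1 hx.2] with y hy
        rw [hd1 y hy]; ring
      rw [hev.deriv_eq]
      exact ((hsol.hasDerivAt_flux (Ioo_subset_Ioo_three hlam hx)).const_mul C).deriv
    rw [hflux, hfIoo x hx]
    ring
  · -- support
    intro x hx
    simp only [hf, if_neg (not_le.mpr hx)]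
  · rw [hZf]; exact hZfin.union (hZfin.image _)
  · rw [hZf, ncard_union_eq ?_ hZfin (hZfin.image _), ncard_image_of_injective _ neg_injective, hN]
    · ring
    · exact disjoint_left.mpr fun x hx ⟨y, hy, hxy⟩ ↦ by
        have := hy.1.1; have := hx.1.1; rw [← hxy] at this; linarith
  · -- normalisation
    have hcongr : EqOn (fun x ↦ f x ^ 2) (fun x ↦ C ^ 2 * frobSol lam b |x| ^ 2)
        (uIcc (-lam) lam) := by
      intro x hx
      rw [Set.uIcc_of_le (by linarith)] at hx
      have hxabs : |x| ≤ lam := abs_le.mpr ⟨hx.1, hx.2⟩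
      simp only [hf, if_pos hxabs]
      ring
    rw [intervalIntegral.integral_congr hcongr, intervalIntegral.integral_const_mul]
    have habs : ContinuousOn (fun x ↦ frobSol lam b |x| ^ 2) (Icc (-lam) lam) := by
      refine (hcont.comp continuous_abs.continuousOn fun x hx ↦ ?_).pow 2
      exact ⟨abs_nonneg x, abs_le.mpr ⟨hx.1, hx.2⟩⟩
    have hi1 : IntervalIntegrable (fun x ↦ frobSol lam b |x| ^ 2) volume (-lam) 0 :=
      (habs.mono (Icc_subset_Icc le_rfl hlam.le)).intervalIntegrable_of_Icc (by linarith)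
    have hi2 : IntervalIntegrable (fun x ↦ frobSol lam b |x| ^ 2) volume 0 lam :=
      (habs.mono (Icc_subset_Icc (by linarith) le_rfl)).intervalIntegrable_of_Icc hlam.le
    rw [← intervalIntegral.integral_add_adjacent_intervals hi1 hi2]
    have hleft : ∫ x in (-lam)..0, frobSol lam b |x| ^ 2 = I := by
      have hc : EqOn (fun x ↦ frobSol lam b |x| ^ 2) (fun x ↦ frobSol lam b (-x) ^ 2)
          (uIcc (-lam) 0) := by
        intro x hx
        rw [Set.uIcc_of_le (by linarith)] at hx
        simp only [abs_of_nonpos hx.2]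
      rw [intervalIntegral.integral_congr hc,
        intervalIntegral.integral_comp_neg (fun x ↦ frobSol lam b x ^ 2)]
      simp [hIdef]
    have hright : ∫ x in (0 : ℝ)..lam, frobSol lam b |x| ^ 2 = I := by
      have hc : EqOn (fun x ↦ frobSol lam b |x| ^ 2) (fun x ↦ frobSol lam b x ^ 2)
          (uIcc 0 lam) := by
        intro x hx
        rw [Set.uIcc_of_le hlam.le] at hx
        simp only [abs_of_nonneg hx.1]
      rw [intervalIntegral.integral_congr hc, hIdef]
    rw [hleft, hright]
    linear_combination hC2
  · -- positivity at `0`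
    have : f 0 = s * frobSol lam b 0 / Real.sqrt (2 * I) := by
      simp only [hf, abs_zero, if_pos hlam.le, hC]
      ring
    rw [this]
    exact div_pos hsA hsqrt

/-- `C_b² · (2 I_b) = 1`. [cite: SlepianPollak1961, §III] -/
theorem frobC_sq_mul {lam : ℝ} (hlam : 0 < lam) (b : ℝ) : frobC lam b ^ 2 * (2 * frobI lam b) = 1 := by
  have hIpos : 0 < frobI lam b := integral_frobSol_sq_pos hlam b
  have hs1 : frobSign lam b ^ 2 = 1 := by unfold frobSign; split_ifs <;> norm_num
  rw [frobC, div_pow, hs1, Real.sq_sqrt (by positivity)]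
  field_simp

/-- `f(λ) = C_b` (as `u_b(λ) = 1`). [cite: SlepianPollak1961, §III] -/
theorem frobWitness_self {lam : ℝ} (hlam : 0 < lam) (b : ℝ) : frobWitness lam b lam = frobC lam b := by
  simp [frobWitness, abs_of_pos hlam]

/-- `f(0) = C_b · u_b(0)`. [cite: SlepianPollak1961, §III] -/
theorem frobWitness_zero {lam : ℝ} (hlam : 0 < lam) (b : ℝ) :
    frobWitness lam b 0 = frobC lam b * frobSol lam b 0 := by
  simp [frobWitness, hlam.le]

/-- `∫ f = 2 C_b ∫₀¹ u_b` at `λ = 1` (evenness + support). [cite: SlepianPollak1961, §III] -/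
theorem integral_frobWitness_one {b : ℝ} (hB : frobSol₁ 1 b 0 = 0) :
    ∫ x, frobWitness 1 b x = 2 * frobC 1 b * ∫ x in (0:ℝ)..1, frobSol 1 b x := by
  have hind : frobWitness 1 b = (Icc (-1 : ℝ) 1).indicator (fun x ↦ frobC 1 b * frobSol 1 b |x|) := by
    funext x
    by_cases hx : x ∈ Icc (-1 : ℝ) 1
    · rw [indicator_of_mem hx, frobWitness, if_pos (abs_le.mpr ⟨hx.1, hx.2⟩)]
    · rw [indicator_of_notMem hx, frobWitness, if_neg]
      intro h
      exact hx ⟨(abs_le.mp h).1, (abs_le.mp h).2⟩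
  rw [hind, MeasureTheory.integral_indicator measurableSet_Icc, integral_Icc_eq_integral_Ioc,
    ← intervalIntegral.integral_of_le (by norm_num : (-1 : ℝ) ≤ 1)]
  have hcont := continuousOn_frobSol_Icc one_pos b
  have habs : ContinuousOn (fun x ↦ frobC 1 b * frobSol 1 b |x|) (Icc (-1) 1) := by
    refine continuousOn_const.mul (hcont.comp continuous_abs.continuousOn fun x hx ↦ ?_)
    exact ⟨abs_nonneg x, abs_le.mpr ⟨hx.1, hx.2⟩⟩
  have hi1 : IntervalIntegrable (fun x ↦ frobC 1 b * frobSol 1 b |x|) volume (-1) 0 :=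
    (habs.mono (Icc_subset_Icc le_rfl zero_le_one)).intervalIntegrable_of_Icc (by norm_num)
  have hi2 : IntervalIntegrable (fun x ↦ frobC 1 b * frobSol 1 b |x|) volume 0 1 :=
    (habs.mono (Icc_subset_Icc (by norm_num) le_rfl)).intervalIntegrable_of_Icc zero_le_one
  rw [← intervalIntegral.integral_add_adjacent_intervals hi1 hi2]
  have heven := fun x (hx : x ∈ Ioo (-1 : ℝ) 1) ↦ frobSol_neg_eq one_pos hB hx
  have hright : ∫ x in (0 : ℝ)..1, frobC 1 b * frobSol 1 b |x| = frobC 1 b * ∫ x in (0:ℝ)..1, frobSol 1 b x := by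
    rw [← intervalIntegral.integral_const_mul]
    refine intervalIntegral.integral_congr fun x hx ↦ ?_
    rw [Set.uIcc_of_le zero_le_one] at hx
    simp only [abs_of_nonneg hx.1]
  have hleft : ∫ x in (-1 : ℝ)..0, frobC 1 b * frobSol 1 b |x| = frobC 1 b * ∫ x in (0:ℝ)..1, frobSol 1 b x := by
    have hc : EqOn (fun x ↦ frobC 1 b * frobSol 1 b |x|) (fun x ↦ frobC 1 b * frobSol 1 b (-x))
        (uIcc (-1 : ℝ) 0) := by
      intro x hx
      rw [Set.uIcc_of_le (by norm_num)] at hx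
      simp only [abs_of_nonpos hx.2]
    rw [intervalIntegral.integral_congr hc,
      intervalIntegral.integral_comp_neg (fun x ↦ frobC 1 b * frobSol 1 b x)]
    simp only [neg_neg, neg_zero]
    rw [← intervalIntegral.integral_const_mul]
  rw [hleft, hright]
  ring

/-- **Values of ANY prolate function with `2k` zeros in terms of `u_b`** (`λ = 1`): by uniqueness
(`IsProlateFunction.unique`) it is the explicit witness, so `f(1)² · 2∫₀¹u_b² = 1`,
`f(0) = f(1) · u_b(0)` and `∫ f = f(1) · 2∫₀¹ u_b`.
[cite: SlepianPollak1961, §III; ConnesConsaniMoscovici2025, §7 (7.9)–(7.12)] -/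
theorem values_of_frob {b : ℝ} {k : ℕ} (hB : frobSol₁ 1 b 0 = 0) (hN : frobZeros 1 b = k)
    {f : ℝ → ℝ} (hf : IsProlateFunction 1 (2 * k) f) :
    f 1 ^ 2 * (2 * ∫ x in (0:ℝ)..1, frobSol 1 b x ^ 2) = 1 ∧
      f 0 = f 1 * frobSol 1 b 0 ∧
      ∫ x, f x = f 1 * (2 * ∫ x in (0:ℝ)..1, frobSol 1 b x) := by
  have hw := isProlateFunction_frobWitness one_pos hB (k := k) (by rw [← frobZeros_def]; exact hN)
  have hfw : f = frobWitness 1 b := hf.unique hw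
  subst hfw
  rw [frobWitness_self one_pos, frobWitness_zero one_pos, integral_frobWitness_one hB]
  exact ⟨frobC_sq_mul one_pos b, rfl, by ring⟩

/-! ### The certificate, its checker and the soundness theorem -/

/-- `π² < 9.8697` (from `π < 3.1416`). [folklore] -/
private theorem pi_sq_lt : π ^ 2 < (9.8697 : ℝ) := by
  have h1 := Real.pi_lt_d4
  have h2 := Real.pi_pos
  nlinarith

/-- `39.476 < 4π² < 39.4787` (from `3.1415 < π < 3.1416`). [folklore] -/
private theorem four_pi_sq_bounds : (39.476 : ℝ) < 4 * π ^ 2 ∧ 4 * π ^ 2 < 39.4787 := by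
  have h1 := Real.pi_lt_d4
  have h2 := Real.pi_gt_d4
  constructor <;> nlinarith

/-- The propagation condition at `r = 3/4` with `π²` replaced by the rational `9.8697`. [cite: CoddingtonLevinson1955, Ch. 4 §8] -/
def condQ (M J : ℕ) : Bool :=
  decide ((((J : ℚ) * ((J : ℚ) + 1) + M) * (9 / 16) + 8 * (98697 / 10000) * (3 / 4) + 4 * (98697 / 10000))
    ≤ 2 * ((J : ℚ) + 1) ^ 2 * (27 / 64))

/-- Soundness of `condQ`. [cite: CoddingtonLevinson1955, Ch. 4 §8] -/
theorem cond_of_condQ {M J : ℕ} (h : condQ M J = true) : Cond (M : ℝ) (3 / 4) J := by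
  have hq : (((J : ℝ) * ((J : ℝ) + 1) + (M : ℝ)) * (9 / 16) + 8 * (98697 / 10000) * (3 / 4)
      + 4 * (98697 / 10000)) ≤ 2 * ((J : ℝ) + 1) ^ 2 * (27 / 64) := by
    have h' := of_decide_eq_true h
    have h'' : ((((J : ℚ) * ((J : ℚ) + 1) + M) * (9 / 16) + 8 * (98697 / 10000) * (3 / 4)
        + 4 * (98697 / 10000) : ℚ) : ℝ) ≤ ((2 * ((J : ℚ) + 1) ^ 2 * (27 / 64) : ℚ) : ℝ) := by
      exact_mod_cast h'
    push_cast at h''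
    exact h''
  unfold Cond
  have hp := pi_sq_lt
  have hJ : (0 : ℝ) ≤ (J : ℝ) * ((J : ℝ) + 1) + (M : ℝ) := by positivity
  nlinarith

/-- The check `|4π² − χ| ≤ M` on `[blo, bhi]`, from `39.476 < 4π² < 39.4787`. [cite: Moore1979, Sect. 2.2 (2.16)–(2.21)] -/
def mOK (M : ℕ) (blo bhi : ℚ) : Bool :=
  decide ((394787 / 10000 : ℚ) - blo ≤ M) && decide (bhi - (39476 / 1000 : ℚ) ≤ M)

/-- Soundness of `mOK`. [cite: Moore1979, Sect. 2.2 (2.16)–(2.21)] -/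
theorem abs_le_of_mOK {M : ℕ} {blo bhi : ℚ} (h : mOK M blo bhi = true) {χ : ℝ}
    (h1 : (blo : ℝ) ≤ χ) (h2 : χ ≤ bhi) : |4 * π ^ 2 - χ| ≤ (M : ℝ) := by
  simp only [mOK, Bool.and_eq_true, decide_eq_true_eq] at h
  obtain ⟨ha, hb⟩ := h
  have ha' : (((394787 / 10000 : ℚ) - blo : ℚ) : ℝ) ≤ ((M : ℚ) : ℝ) := by exact_mod_cast ha
  have hb' : ((bhi - (39476 / 1000 : ℚ) : ℚ) : ℝ) ≤ ((M : ℚ) : ℝ) := by exact_mod_cast hb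
  obtain ⟨hl, hu⟩ := four_pi_sq_bounds
  rw [abs_le]
  push_cast at ha' hb'
  constructor <;> linarith

/-- **The certificate format.**  Scale `S`, window start `J` (the value polynomial has `J + 3` terms),
bisection depth `d`, the bound `M ≥ |4π² − χ|`, the zero count `k`, the bracket `[blo, bhi]` of the
eigen-parameter, `k + 1` sign points for `u_{blo}`, the cells for `u_{bhi}`, and the CLAIMED
enclosures of `λ² = 4I₁²/u₀²`, `(λ f(1))² = 2I₁²/(u₀²I₂)` and `t = 4I₁²/(I₂(u₀² − 4I₁²))`. [cite: CoddingtonLevinson1955, Ch. 8 §2 Thm 2.1] -/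
structure Cert where
  /-- binary scale of the fixed-point intervals -/
  S : ℕ
  /-- window start of the geometric majorant (`J + 3` coefficients are used) -/
  J : ℕ
  /-- bisection depth of the sign checkers -/
  d : ℕ
  /-- a bound for `|4π² − χ|` on the bracket -/
  M : ℕ
  /-- the number of zeros of `u_b` in `(0, 1)` (the prolate function has `2k` zeros) -/
  k : ℕ
  /-- lower end of the eigen-parameter bracket -/
  blo : ℚ
  /-- upper end of the eigen-parameter bracket -/
  bhi : ℚ
  /-- `k + 1` increasing points of `[0, 1)` where `u_{blo}` alternates in sign -/
  pts : List ℚ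
  /-- a partition of `[0, 1]` (in `t = 1 − x`) into cells `(τ, mono, pos)` of `u_{bhi}`: zero-free
  (`mono = false`, sign of `u` = `pos`) or monotone (`mono = true`, sign of `u′` = `pos`) -/
  cells : List (ℚ × Bool × Bool)
  /-- claimed lower bound of `λ²` -/
  lam2lo : ℚ
  /-- claimed upper bound of `λ²` -/
  lam2hi : ℚ
  /-- claimed lower bound of `(λ f(1))²` -/
  lp2lo : ℚ
  /-- claimed lower bound of `t = 2λ²f(1)²/(1 − λ²)` -/
  tlo : ℚ
  /-- claimed upper bound of `t` -/
  thi : ℚ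

namespace Cert

variable (c : Cert)

/-- The bracket as an interval. [cite: Moore1979, Sect. 2.2 (2.16)–(2.21)] -/
def X : MI := MI.span (ofRat c.S c.blo) (ofRat c.S c.bhi)
/-- The lower end as a point interval. [cite: Moore1979, Sect. 2.2 (2.16)–(2.21)] -/
def Xlo : MI := ofRat c.S c.blo
/-- The upper end as a point interval. [cite: Moore1979, Sect. 2.2 (2.16)–(2.21)] -/
def Xhi : MI := ofRat c.S c.bhi
/-- Enclosure of `u_b(0)`. [cite: Moore1979, Sect. 2.2 (2.16)–(2.21)] -/
def U0 : MI := u0I c.S c.X c.J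
/-- Enclosure of `I₁ = ∫₀¹ u_b`. [cite: Moore1979, Sect. 2.2 (2.16)–(2.21)] -/
def I1 : MI := i1I c.S c.X c.J
/-- Enclosure of `I₂ = ∫₀¹ u_b²`. [cite: Moore1979, Sect. 2.2 (2.16)–(2.21)] -/
def I2 : MI := i2I c.S c.X c.J
/-- Enclosure of `u_b(0)²`. [cite: Moore1979, Sect. 2.2 (2.16)–(2.21)] -/
def U0sq : MI := MI.sqr c.S c.U0
/-- Enclosure of `I₁²`. [cite: Moore1979, Sect. 2.2 (2.16)–(2.21)] -/
def I1sq : MI := MI.sqr c.S c.I1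
/-- Enclosure of `λ² = 4I₁²/u₀²`. [cite: Moore1979, Sect. 2.2 (2.16)–(2.21)] -/
def LAM2 : Option MI := MI.divPos c.S (c.I1sq.mulInt 4) c.U0sq
/-- Enclosure of `(λf(1))² = 2I₁²/(u₀²I₂)`. [cite: Moore1979, Sect. 2.2 (2.16)–(2.21)] -/
def LP2 : Option MI := MI.divPos c.S (c.I1sq.mulInt 2) (MI.mul c.S c.U0sq c.I2)
/-- Enclosure of `t = 4I₁²/(I₂(u₀² − 4I₁²))`. [cite: Moore1979, Sect. 2.2 (2.16)–(2.21)] -/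
def T : Option MI := MI.divPos c.S (c.I1sq.mulInt 4) (MI.mul c.S c.I2 (MI.sub c.U0sq (c.I1sq.mulInt 4)))

/-- The zero-count lower-bound check (trivial for `k = 0`). [cite: Kearfott1987, Sect. 1; AlefeldMayer2000, Sect. 4] -/
def lowOK : Bool :=
  match c.pts with
  | [] => decide (c.k = 0)
  | x :: rest => altOK c.S c.Xlo c.J (x :: rest) && decide (rest.length = c.k)

/-- The comparison of the computed enclosures with the claimed bounds. [cite: Moore1979, Sect. 2.2 (2.16)–(2.21)] -/
def encOK : Bool :=
  match c.LAM2, c.LP2, c.T with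
  | some L, some P, some T =>
      qLeI c.S c.lam2lo L && iLeQ c.S L c.lam2hi && qLeI c.S c.lp2lo P && qLeI c.S c.tlo T && iLeQ c.S T c.thi
  | _, _, _ => false

/-- **The checker** (one kernel-evaluable `Bool`). [cite: CoddingtonLevinson1955, Ch. 8 §2 Thm 2.1] -/
def check : Bool :=
  decide (0 < c.S) && decide (c.blo ≤ c.bhi) && mOK c.M c.blo c.bhi && condQ c.M c.J &&
    (bsgn c.S c.Xlo c.J * bsgn c.S c.Xhi c.J == -1) && c.lowOK &&
    cellsOK c.S c.Xhi c.J c.d 0 c.cells && decide (monoCount c.cells ≤ c.k) &&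
    decide (0 < c.I2.lo) && c.encOK

/-- `divPos` succeeds only on a positive denominator. [folklore] -/
private theorem lo_pos_of_divPos {S : ℕ} {I J K : MI} (h : MI.divPos S I J = some K) : 0 < J.lo := by
  by_contra hlo
  unfold MI.divPos at h
  rw [if_neg hlo] at h
  exact absurd h (by simp)

/-- A value of `bsgn` is `1`, `−1` or `0`. [folklore] -/
private theorem bsgn_cases (S : ℕ) (X : MI) (J : ℕ) :
    bsgn S X J = 1 ∨ bsgn S X J = -1 ∨ bsgn S X J = 0 := by
  unfold bsgn; dsimp only; split_ifs <;> simp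

/-- `k ≤ N(blo)` from `lowOK`. [folklore] -/
private theorem k_le_frobZeros_of_lowOK {c : Cert} (hS : 0 < c.S) {M : ℝ} (hM : |4 * π ^ 2 - (c.blo : ℝ)| ≤ M)
    (hcond : Cond M (3 / 4) c.J) (h : c.lowOK = true) : c.k ≤ frobZeros 1 (c.blo : ℝ) := by
  unfold lowOK at h
  cases hp : c.pts with
  | nil => simp [hp] at h; rw [h]; exact Nat.zero_le _
  | cons x rest =>
      simp only [hp, Bool.and_eq_true, decide_eq_true_eq] at h
      obtain ⟨halt, hlen⟩ := h
      rw [← hlen]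
      exact le_frobZeros_of_altOK hS (mem_ofRat c.S c.blo) hM hcond halt

/-- **Soundness of the checker (Frobenius form).**  An accepted certificate yields a parameter `b` in
the bracket with `u_b′(0) = 0`, exactly `k` zeros of `u_b` in `(0,1)`, and the claimed enclosures of
`4I₁²/u₀²`, `2I₁²/(u₀²I₂)`, `4I₁²/(I₂(u₀² − 4I₁²))` (with positive denominators).
[cite: CoddingtonLevinson1955, Ch. 8 §2 Thm 2.1; SlepianPollak1961, §III] -/
theorem sound (h : c.check = true) :
    ∃ b : ℝ, frobSol₁ 1 b 0 = 0 ∧ frobZeros 1 b = c.k ∧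
      0 < (∫ x in (0:ℝ)..1, frobSol 1 b x ^ 2) ∧
      0 < frobSol 1 b 0 ^ 2 ∧
      0 < frobSol 1 b 0 ^ 2 - 4 * (∫ x in (0:ℝ)..1, frobSol 1 b x) ^ 2 ∧
      (c.lam2lo : ℝ) ≤ 4 * (∫ x in (0:ℝ)..1, frobSol 1 b x) ^ 2 / frobSol 1 b 0 ^ 2 ∧
      4 * (∫ x in (0:ℝ)..1, frobSol 1 b x) ^ 2 / frobSol 1 b 0 ^ 2 ≤ c.lam2hi ∧
      (c.lp2lo : ℝ) ≤ 2 * (∫ x in (0:ℝ)..1, frobSol 1 b x) ^ 2 /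
        (frobSol 1 b 0 ^ 2 * ∫ x in (0:ℝ)..1, frobSol 1 b x ^ 2) ∧
      (c.tlo : ℝ) ≤ 4 * (∫ x in (0:ℝ)..1, frobSol 1 b x) ^ 2 /
        ((∫ x in (0:ℝ)..1, frobSol 1 b x ^ 2) * (frobSol 1 b 0 ^ 2 - 4 * (∫ x in (0:ℝ)..1, frobSol 1 b x) ^ 2)) ∧
      4 * (∫ x in (0:ℝ)..1, frobSol 1 b x) ^ 2 /
        ((∫ x in (0:ℝ)..1, frobSol 1 b x ^ 2) * (frobSol 1 b 0 ^ 2 - 4 * (∫ x in (0:ℝ)..1, frobSol 1 b x) ^ 2))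
        ≤ c.thi := by
  unfold check at h
  simp only [Bool.and_eq_true, decide_eq_true_eq, beq_iff_eq] at h
  obtain ⟨⟨⟨⟨⟨⟨⟨⟨⟨hS, hle⟩, hMok⟩, hcQ⟩, hsgn⟩, hlow⟩, hcells⟩, hmono⟩, hI2lo⟩, henc⟩ := h
  have hcond : Cond (c.M : ℝ) (3 / 4) c.J := cond_of_condQ hcQ
  have hmlo : MI.mem c.S (c.blo : ℝ) c.Xlo := mem_ofRat c.S c.blo
  have hmhi : MI.mem c.S (c.bhi : ℝ) c.Xhi := mem_ofRat c.S c.bhi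
  have hleR : (c.blo : ℝ) ≤ c.bhi := by exact_mod_cast hle
  have hMlo : |4 * π ^ 2 - (c.blo : ℝ)| ≤ (c.M : ℝ) := abs_le_of_mOK hMok le_rfl hleR
  have hMhi : |4 * π ^ 2 - (c.bhi : ℝ)| ≤ (c.M : ℝ) := abs_le_of_mOK hMok hleR le_rfl
  -- the parameter b from the certified sign change of B
  have hcontB : ContinuousOn (fun χ ↦ frobSol₁ 1 χ 0) (Icc (c.blo : ℝ) c.bhi) :=
    (continuous_frobSol₁_zero one_pos).continuousOn
  have hB : ∃ b ∈ Icc (c.blo : ℝ) c.bhi, frobSol₁ 1 b 0 = 0 := by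
    rcases bsgn_cases c.S c.Xlo c.J with h1 | h1 | h1 <;>
      rcases bsgn_cases c.S c.Xhi c.J with h2 | h2 | h2 <;>
      simp only [h1, h2] at hsgn <;> norm_num at hsgn
    · have hp := frobSol₁_zero_pos_of_bsgn hS hmlo hMlo hcond h1
      have hn := frobSol₁_zero_neg_of_bsgn hS hmhi hMhi hcond h2
      obtain ⟨b, hb, hb0⟩ := intermediate_value_Icc' hleR hcontB ⟨hn.le, hp.le⟩
      exact ⟨b, hb, hb0⟩
    · have hn := frobSol₁_zero_neg_of_bsgn hS hmlo hMlo hcond h1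
      have hp := frobSol₁_zero_pos_of_bsgn hS hmhi hMhi hcond h2
      obtain ⟨b, hb, hb0⟩ := intermediate_value_Icc hleR hcontB ⟨hn.le, hp.le⟩
      exact ⟨b, hb, hb0⟩
  obtain ⟨b, hb, hb0⟩ := hB
  have hMb : |4 * π ^ 2 - b| ≤ (c.M : ℝ) := abs_le_of_mOK hMok hb.1 hb.2
  have hbX : MI.mem c.S b c.X := MI.mem_span hmlo hmhi hb.1 hb.2
  -- the zero count
  have hN : frobZeros 1 b = c.k := by
    have h1 : c.k ≤ frobZeros 1 (c.blo : ℝ) := k_le_frobZeros_of_lowOK hS hMlo hcond hlow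
    have h2 : frobZeros 1 (c.blo : ℝ) ≤ frobZeros 1 b := frobZeros_mono one_pos hb.1
    have h3 : frobZeros 1 b ≤ frobZeros 1 (c.bhi : ℝ) := frobZeros_mono one_pos hb.2
    have h4 : frobZeros 1 (c.bhi : ℝ) ≤ monoCount c.cells := frobZeros_le_of_cellsOK hS hmhi hMhi hcond hcells
    omega
  -- the enclosures at χ = b
  have hu0 := mem_u0I hS hbX hMb hcond
  have hi1 := mem_i1I hS hbX hMb hcond
  have hi2 := mem_i2I hS hbX hMb hcond
  set u0 := frobSol 1 b 0 with hu0def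
  set I1 := ∫ x in (0:ℝ)..1, frobSol 1 b x with hI1def
  set I2 := ∫ x in (0:ℝ)..1, frobSol 1 b x ^ 2 with hI2def
  have hu0sq : MI.mem c.S (u0 ^ 2) c.U0sq := MI.mem_sqr hS hu0
  have hi1sq : MI.mem c.S (I1 ^ 2) c.I1sq := MI.mem_sqr hS hi1
  have hi1sq4 : MI.mem c.S (4 * I1 ^ 2) (c.I1sq.mulInt 4) := by
    have := MI.mem_mulInt hi1sq 4; rw [show (4 : ℝ) * I1 ^ 2 = I1 ^ 2 * ((4:ℤ):ℝ) by push_cast; ring]; exact this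
  have hi1sq2 : MI.mem c.S (2 * I1 ^ 2) (c.I1sq.mulInt 2) := by
    have := MI.mem_mulInt hi1sq 2; rw [show (2 : ℝ) * I1 ^ 2 = I1 ^ 2 * ((2:ℤ):ℝ) by push_cast; ring]; exact this
  have hI2pos : 0 < I2 := MI.pos_of_lo_pos hi2 hI2lo
  -- destructure encOK
  unfold encOK at henc
  cases hL : c.LAM2 with
  | none => simp [hL] at henc
  | some L =>
    cases hP : c.LP2 with
    | none => simp [hL, hP] at henc
    | some P =>
      cases hT : c.T with
      | none => simp [hL, hP, hT] at henc
      | some T =>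
        simp only [hL, hP, hT, Bool.and_eq_true] at henc
        obtain ⟨⟨⟨⟨e1, e2⟩, e3⟩, e4⟩, e5⟩ := henc
        -- positivity facts
        have hU0pos : 0 < u0 ^ 2 := MI.pos_of_lo_pos hu0sq (lo_pos_of_divPos hL)
        have hden := MI.mem_mul hS hi2 (MI.mem_sub hu0sq hi1sq4)
        have hdenpos : 0 < I2 * (u0 ^ 2 - 4 * I1 ^ 2) := MI.pos_of_lo_pos hden (lo_pos_of_divPos hT)
        have hgap : 0 < u0 ^ 2 - 4 * I1 ^ 2 := (mul_pos_iff_of_pos_left hI2pos).mp hdenpos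
        -- the three quotients
        have hmL := MI.mem_divPos hS hL hi1sq4 hu0sq
        have hmP := MI.mem_divPos hS hP hi1sq2 (MI.mem_mul hS hu0sq hi2)
        have hmT := MI.mem_divPos hS hT hi1sq4 hden
        refine ⟨b, hb0, hN, hI2pos, hU0pos, hgap, le_of_qLeI e1 hmL hS, le_of_iLeQ e2 hmL hS,
          le_of_qLeI e3 hmP hS, le_of_qLeI e4 hmT hS, le_of_iLeQ e5 hmT hS⟩

/-- **Soundness of the checker (prolate form).**  For the unique prolate function `f` with `2k`
zeros (`λ = 1`, `c = 2π`, tree interface `IsProlateFunction 1 (2k) f`), writing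
`λ = (∫ f)/f(0)` (its eigenvalue under the finite cosine transform), an accepted certificate proves
`λ² ∈ [lam2lo, lam2hi]`, `(λ f(1))² ≥ lp2lo` and `2λ²f(1)²/(1 − λ²) ∈ [tlo, thi]`.
[cite: SlepianPollak1961, §III; ConnesConsaniMoscovici2025, §7 (7.9)–(7.12)] -/
theorem enclosures (h : c.check = true) {f : ℝ → ℝ} (hf : IsProlateFunction 1 (2 * c.k) f) :
    (c.lam2lo : ℝ) ≤ ((∫ x, f x) / f 0) ^ 2 ∧ ((∫ x, f x) / f 0) ^ 2 ≤ c.lam2hi ∧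
      (c.lp2lo : ℝ) ≤ ((∫ x, f x) / f 0 * f 1) ^ 2 ∧
      (c.tlo : ℝ) ≤ 2 * ((∫ x, f x) / f 0) ^ 2 * f 1 ^ 2 / (1 - ((∫ x, f x) / f 0) ^ 2) ∧
      2 * ((∫ x, f x) / f 0) ^ 2 * f 1 ^ 2 / (1 - ((∫ x, f x) / f 0) ^ 2) ≤ c.thi := by
  obtain ⟨b, hb0, hN, hI2, hU0, hgap, h1, h2, h3, h4, h5⟩ := c.sound h
  obtain ⟨hC, hf0, hint⟩ := values_of_frob hb0 hN hf
  set u0 := frobSol 1 b 0 with hu0def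
  set I1 := ∫ x in (0:ℝ)..1, frobSol 1 b x with hI1def
  set I2 := ∫ x in (0:ℝ)..1, frobSol 1 b x ^ 2 with hI2def
  have hu0 : u0 ≠ 0 := by
    intro h0; rw [h0] at hU0; norm_num at hU0
  have hC0 : f 1 ≠ 0 := by
    intro h0; rw [h0] at hC; norm_num at hC
  have hI2' : I2 ≠ 0 := hI2.ne'
  have hg' : u0 ^ 2 - 4 * I1 ^ 2 ≠ 0 := hgap.ne'
  have hlam : (∫ x, f x) / f 0 = 2 * I1 / u0 := by
    rw [hint, hf0]; field_simp
  have hC2 : f 1 ^ 2 = 1 / (2 * I2) := by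
    field_simp; linarith [hC]
  rw [hlam]
  have e1 : (2 * I1 / u0) ^ 2 = 4 * I1 ^ 2 / u0 ^ 2 := by
    field_simp; ring
  have e2 : (2 * I1 / u0 * f 1) ^ 2 = 2 * I1 ^ 2 / (u0 ^ 2 * I2) := by
    rw [mul_pow, hC2]; field_simp
  have e3 : 2 * (2 * I1 / u0) ^ 2 * f 1 ^ 2 / (1 - (2 * I1 / u0) ^ 2)
      = 4 * I1 ^ 2 / (I2 * (u0 ^ 2 - 4 * I1 ^ 2)) := by
    rw [hC2]
    have hden : 1 - (2 * I1 / u0) ^ 2 = (u0 ^ 2 - 4 * I1 ^ 2) / u0 ^ 2 := by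
      field_simp; ring
    rw [hden]
    field_simp
    ring
  rw [e3, e2, e1]
  exact ⟨h1, h2, h3, h4, h5⟩

end Cert

/-! ### The four certificates at `c = 2π` (even prolate functions with `0, 2, 4, 6` zeros) -/

/-- Certificate data for `k = 0` (the prolate function with no zero; bracket of `χ_0(2π) ≈ 5.494094`). [cite: ConnesConsani2021, §4 p. 16] -/
def cert0 : Cert where
  S := 18446744073709551616
  J := 38
  d := 12
  M := 60
  k := 0
  blo := (5.494094019044 : ℚ)
  bhi := (5.494094019064 : ℚ)
  pts := []
  cells := [((0.125 : ℚ), false, true), ((0.25 : ℚ), false, true), ((0.5 : ℚ), false, true), ((1 : ℚ), false, true)]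
  lam2lo := (0.9999427 : ℚ)
  lam2hi := (0.9999428 : ℚ)
  lp2lo := (0.0003426764 : ℚ)
  tlo := (11.97171 : ℚ)
  thi := (11.97215 : ℚ)

/-- Certificate data for `k = 1` (`2` zeros; `χ_2(2π) ≈ 26.834164`). [cite: ConnesConsani2021, §4 p. 16] -/
def cert1 : Cert where
  S := 18446744073709551616
  J := 38
  d := 12
  M := 60
  k := 1
  blo := (26.83416413313 : ℚ)
  bhi := (26.83416413315 : ℚ)
  pts := [(0 : ℚ), ((37 : ℚ) / 57)]
  cells := [(((589851 : ℚ) / 1756600), false, true), (((589851 : ℚ) / 878300), false, true), (((642549 : ℚ) / 878300), true, true), ((1 : ℚ), false, false)]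
  lam2lo := (0.9593903 : ℚ)
  lam2hi := (0.9593904 : ℚ)
  lp2lo := (0.1781899 : ℚ)
  tlo := (8.775741 : ℚ)
  thi := (8.775745 : ℚ)

/-- Certificate data for `k = 2` (`4` zeros; `χ_4(2π) ≈ 42.916034`). [cite: ConnesConsani2021, §4 p. 16] -/
def cert2 : Cert where
  S := 18446744073709551616
  J := 38
  d := 12
  M := 60
  k := 2
  blo := (42.916033756789 : ℚ)
  bhi := (42.916033756809 : ℚ)
  pts := [(0 : ℚ), ((38 : ℚ) / 81), ((57 : ℚ) / 67)]
  cells := [(((113199 : ℚ) / 421700), false, true), (((138501 : ℚ) / 421700), true, true), (((43814971 : ℚ) / 82551992), false, false), (((44846 : ℚ) / 61175), false, false), (((97033 : ℚ) / 122350), true, false), ((1 : ℚ), false, true)]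
  lam2lo := (0.274666 : ℚ)
  lam2hi := (0.2746661 : ℚ)
  lp2lo := (0.7997808 : ℚ)
  tlo := (2.205276 : ℚ)
  thi := (2.205277 : ℚ)

/-- Certificate data for `k = 3` (`6` zeros; `χ_6(2π) ≈ 63.158589`). [cite: ConnesConsani2021, §4 p. 16] -/
def cert3 : Cert where
  S := 18446744073709551616
  J := 38
  d := 12
  M := 60
  k := 3
  blo := (63.158588742949 : ℚ)
  bhi := (63.158588742969 : ℚ)
  pts := [(0 : ℚ), ((37 : ℚ) / 96), ((52 : ℚ) / 71), ((69 : ℚ) / 73)]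
  cells := [(((28539 : ℚ) / 358700), false, true), (((50061 : ℚ) / 358700), true, true), (((32139 : ℚ) / 120059), false, false), (((382881 : ℚ) / 967300), false, false), (((440919 : ℚ) / 967300), true, false), (((45059834 : ℚ) / 73272975), false, true), (((4691 : ℚ) / 6060), false, true), (((25273 : ℚ) / 30300), true, true), ((1 : ℚ), false, false)]
  lam2lo := (0.003478237 : ℚ)
  lam2hi := (0.003478239 : ℚ)
  lp2lo := (0.02162363 : ℚ)
  tlo := (0.04339821 : ℚ)
  thi := (0.04339835 : ℚ)

/-- **Kernel evaluation of the certificate for `k = 0`.** [cite: ConnesConsani2021, §4 p. 16 (λ(0)); Lemma 5.4 §5 p. 19 (t(0))] -/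
theorem cert0_check : cert0.check = true := by
  decide +kernel

/-- **Certified enclosures for the even prolate function with `0` zeros** (`c = 2π`, `λ = 1`,
tree normalisation `∫_{−1}^1 f² = 1`): with `λ := (∫ f)/f(0)`,
`λ² ∈ [0.9999427, 0.9999428]`, `(λ f(1))² ≥ 0.0003426764`, `2λ²f(1)²/(1 − λ²) ∈ [11.97171, 11.97215]`
(printed: `λ(0)`, `t(0)` of Connes–Consani 2021 §4 p. 16 / Lemma 5.4).
[cite: ConnesConsani2021, §4 p. 16 (λ(n)); Lemma 5.4 §5 p. 19 (t(n)); SlepianPollak1961, §III] -/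
theorem enclosures_zero {f : ℝ → ℝ} (hf : IsProlateFunction 1 (2 * 0) f) :
    (0.9999427 : ℝ) ≤ ((∫ x, f x) / f 0) ^ 2 ∧ ((∫ x, f x) / f 0) ^ 2 ≤ 0.9999428 ∧
      (0.0003426764 : ℝ) ≤ ((∫ x, f x) / f 0 * f 1) ^ 2 ∧
      (11.97171 : ℝ) ≤ 2 * ((∫ x, f x) / f 0) ^ 2 * f 1 ^ 2 / (1 - ((∫ x, f x) / f 0) ^ 2) ∧
      2 * ((∫ x, f x) / f 0) ^ 2 * f 1 ^ 2 / (1 - ((∫ x, f x) / f 0) ^ 2) ≤ 11.97215 := by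
  have h := cert0.enclosures cert0_check hf
  norm_num [cert0] at h ⊢
  exact h

/-- **Kernel evaluation of the certificate for `k = 1`.** [cite: ConnesConsani2021, §4 p. 16 (λ(1)); Lemma 5.4 §5 p. 19 (t(1))] -/
theorem cert1_check : cert1.check = true := by
  decide +kernel

/-- **Certified enclosures for the even prolate function with `2` zeros** (`c = 2π`, `λ = 1`,
tree normalisation `∫_{−1}^1 f² = 1`): with `λ := (∫ f)/f(0)`,
`λ² ∈ [0.9593903, 0.9593904]`, `(λ f(1))² ≥ 0.1781899`, `2λ²f(1)²/(1 − λ²) ∈ [8.775741, 8.775745]`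
(printed: `λ(1)`, `t(1)` of Connes–Consani 2021 §4 p. 16 / Lemma 5.4).
[cite: ConnesConsani2021, §4 p. 16 (λ(n)); Lemma 5.4 §5 p. 19 (t(n)); SlepianPollak1961, §III] -/
theorem enclosures_one {f : ℝ → ℝ} (hf : IsProlateFunction 1 (2 * 1) f) :
    (0.9593903 : ℝ) ≤ ((∫ x, f x) / f 0) ^ 2 ∧ ((∫ x, f x) / f 0) ^ 2 ≤ 0.9593904 ∧
      (0.1781899 : ℝ) ≤ ((∫ x, f x) / f 0 * f 1) ^ 2 ∧
      (8.775741 : ℝ) ≤ 2 * ((∫ x, f x) / f 0) ^ 2 * f 1 ^ 2 / (1 - ((∫ x, f x) / f 0) ^ 2) ∧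
      2 * ((∫ x, f x) / f 0) ^ 2 * f 1 ^ 2 / (1 - ((∫ x, f x) / f 0) ^ 2) ≤ 8.775745 := by
  have h := cert1.enclosures cert1_check hf
  norm_num [cert1] at h ⊢
  exact h

/-- **Kernel evaluation of the certificate for `k = 2`.** [cite: ConnesConsani2021, §4 p. 16 (λ(2)); Lemma 5.4 §5 p. 19 (t(2))] -/
theorem cert2_check : cert2.check = true := by
  decide +kernel

/-- **Certified enclosures for the even prolate function with `4` zeros** (`c = 2π`, `λ = 1`,
tree normalisation `∫_{−1}^1 f² = 1`): with `λ := (∫ f)/f(0)`,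
`λ² ∈ [0.274666, 0.2746661]`, `(λ f(1))² ≥ 0.7997808`, `2λ²f(1)²/(1 − λ²) ∈ [2.205276, 2.205277]`
(printed: `λ(2)`, `t(2)` of Connes–Consani 2021 §4 p. 16 / Lemma 5.4).
[cite: ConnesConsani2021, §4 p. 16 (λ(n)); Lemma 5.4 §5 p. 19 (t(n)); SlepianPollak1961, §III] -/
theorem enclosures_two {f : ℝ → ℝ} (hf : IsProlateFunction 1 (2 * 2) f) :
    (0.274666 : ℝ) ≤ ((∫ x, f x) / f 0) ^ 2 ∧ ((∫ x, f x) / f 0) ^ 2 ≤ 0.2746661 ∧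
      (0.7997808 : ℝ) ≤ ((∫ x, f x) / f 0 * f 1) ^ 2 ∧
      (2.205276 : ℝ) ≤ 2 * ((∫ x, f x) / f 0) ^ 2 * f 1 ^ 2 / (1 - ((∫ x, f x) / f 0) ^ 2) ∧
      2 * ((∫ x, f x) / f 0) ^ 2 * f 1 ^ 2 / (1 - ((∫ x, f x) / f 0) ^ 2) ≤ 2.205277 := by
  have h := cert2.enclosures cert2_check hf
  norm_num [cert2] at h ⊢
  exact h

/-- **Kernel evaluation of the certificate for `k = 3`.** [cite: ConnesConsani2021, §4 p. 16 (λ(3)); Lemma 5.4 §5 p. 19 (t(3))] -/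
theorem cert3_check : cert3.check = true := by
  decide +kernel

/-- **Certified enclosures for the even prolate function with `6` zeros** (`c = 2π`, `λ = 1`,
tree normalisation `∫_{−1}^1 f² = 1`): with `λ := (∫ f)/f(0)`,
`λ² ∈ [0.003478237, 0.003478239]`, `(λ f(1))² ≥ 0.02162363`, `2λ²f(1)²/(1 − λ²) ∈ [0.04339821, 0.04339835]`
(printed: `λ(3)`, `t(3)` of Connes–Consani 2021 §4 p. 16 / Lemma 5.4).
[cite: ConnesConsani2021, §4 p. 16 (λ(n)); Lemma 5.4 §5 p. 19 (t(n)); SlepianPollak1961, §III] -/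
theorem enclosures_three {f : ℝ → ℝ} (hf : IsProlateFunction 1 (2 * 3) f) :
    (0.003478237 : ℝ) ≤ ((∫ x, f x) / f 0) ^ 2 ∧ ((∫ x, f x) / f 0) ^ 2 ≤ 0.003478239 ∧
      (0.02162363 : ℝ) ≤ ((∫ x, f x) / f 0 * f 1) ^ 2 ∧
      (0.04339821 : ℝ) ≤ 2 * ((∫ x, f x) / f 0) ^ 2 * f 1 ^ 2 / (1 - ((∫ x, f x) / f 0) ^ 2) ∧
      2 * ((∫ x, f x) / f 0) ^ 2 * f 1 ^ 2 / (1 - ((∫ x, f x) / f 0) ^ 2) ≤ 0.04339835 := by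
  have h := cert3.enclosures cert3_check hf
  norm_num [cert3] at h ⊢
  exact h

end ProlateCert

end Literature.NumberTheory.LFunctions
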